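import Literature.NumberTheory.LFunctions.KMVFirstMomentBeyondDiagonal
import Literature.NumberTheory.LFunctions.KMVCentralValueSquaredAFESeries
import Literature.NumberTheory.LFunctions.KowalskiMichelPeterssonBoundWeilFree
import Literature.NumberTheory.Sieve.DivisorBound
import Mathlib.Analysis.SumIntegralComparisons
import Mathlib.Analysis.SpecialFunctions.Integrals.Basic
import HarnessLib

/-!
# KMV 2000, §5 p. 13 — the Weil half of the printed range: the mollified off-diagonal of the
# harmonic second moment at prime level is an error term for mollifier length `M = q̂^Δ`, `Δ < 1/2`
# (`X²` profile, `Q = 1`; everything PROVED — no definition, no named fact)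

Kowalski–Michel–VanderKam 2000 [held: paper:doi-10-1515-crll-2000-074], §5 p. 13: «Integrating by
parts and using Lemma 3.3, one shows (see [I-S] or [VdK2] for details) that the terms coming from
the Kloosterman sums have a total contribution which is `≪ q̂^{1−γ}` for some `γ = γ(Δ) > 0` if
`Δ < 1` (if one uses the Weil bound on the individual Kloosterman sums, this follows only in the
range `Δ < 1/2`)»; Lemma 3.2 (12) p. 8: «This last bound turns out to be sufficient to allow us to
take a mollifier of length `M = q̂^Δ` for any `Δ < 1/2`». This file PROVES that parenthetical — the
WEIL HALF of the printed diagonal range — for the `X²` profile at `Q = 1` (cell landau-siegel,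
unit `littype-ls-input-kmvdiag`, [INPUT KMV2000.MomentAsymptotics]: the printed-range instance of
the predicate `KMV2000.MomentAsymptotics` is `momentAsymptoticsDiagOnly_of_kmv`, conditional on the
named facts `kmv2000_firstMomentPQ` / `kmv2000_secondMomentPQ`; its consumers use it at `Q = 1`
for one profile, `KMV2000.goodMass_lower_of_displaysAtOne`).

**`KMV2000.WeilOffDiag.norm_mollified_offDiag_le`.** For `0 < Δ < 1/2` there are `C, q₀` with,
for every prime `q ≥ q₀` and `M = q̂^Δ` (`q̂ = √q/2π`),
`‖Σ_{l,m ≤ M} c_l c_m · OFF_q(l,m)‖ ≤ C · q̂ · (log q̂)^{−3}`, where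
`c_m = μ(m)ψ(m)⁻¹m^{−1/2}(log(M/m)/log M)²` (`KMV2000.mollifierCoeff (X^2)`, KMV (9)) and
`OFF_q(l,m) = 2q̂ Σ_{n₁,n₂ ≥ 1} (n₁n₂)^{−1/2} W(n₁n₂/q̂²) Σ_{d₁∣(l,n₁)} Σ_{d₂∣(m,n₂)} J_q(l n₁/d₁², m n₂/d₂²)`
is the off-diagonal of KMV's (21)–(23) (the exact formula (22) at `k = 0`, `KMV2000.completedL_half_sq_eq_holds`,
⊗ Hecke's recursion (10) ⊗ Petersson (11) at prime level), written out explicitly over `ℕ × ℕ` with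
`W = KMV2000.cutoffW` and `J_q = KowalskiMichel2000.petJ` — literally the series the Summit-side exact
split `PeterssonSplit.QhPQ_X_sq_one_split` (route `PrimeLevelFamEdge`, crux K_B) subtracts, so that its
`PeterssonSplit.offDiag q l m` unfolds to it by `rfl`. The proof gives `≪ (1 + log q̂)·q̂^{1/2+Δ}`.

PROOF (real-variable bookkeeping around two tree inputs, both hypothesis-free):
* `KowalskiMichel2000.norm_petJ_le` — Kowalski–Michel (23) `‖J_q(a,b)‖ ≤ C_ε (ab)^{1/2+ε} q^{−3/2}`
  for `q ∤ (a,b)` (Weil's bound, `KloostermanWeilPrimeProofs`); and for the pairs with `q ∣ a, q ∣ b`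
  (inside `OFF_q(l,m)` this forces `q ∣ n₁, q ∣ n₂`, as `l, m < q`) the all-index bound
  `‖J_q(a,b)‖ ≤ C₀ √(a,b) √(ab) q^{−3/2}` (`norm_petJ_le_gcd`, summing
  `KowalskiMichel2000.norm_petKloostermanTerm_le_all`);
* the decay `W(y) ≤ min(1, 48/y²)` of KMV's cut-off (`cutoffW_le_one`, `cutoffW_le_div_sq`).
Lemma A: `Σ_{(n₁,n₂)} (n₁n₂)^e W(n₁n₂/Q) ≤ 769(1 + log Q)Q^{1+e}` (`0 < e ≤ 1/2`; integral test and
the harmonic sum); Lemma B: `Σ_{q∣n₁,q∣n₂} (n₁n₂)^{1/2} W(n₁n₂/Q) ≤ 48 Q² (q^{−3/2} Σ_k k^{−3/2})²`; with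
the divisor bound `τ(n) ≤ C_τ n^ε` (`Literature.NumberTheory.Sieve.exists_card_divisors_le_mul_rpow`)
and `|c_m| ≤ m^{−1/2}` the mollified sum is `≤ K₁(1 + 2 log q̂) q̂^{2ε} M^{2+4ε} + K₂`, and
`ε = ε(Δ)` is chosen with `2ε + Δ(2 + 4ε) = 1/2 + Δ`.

What this is NOT: nothing for `1/2 ≤ Δ < 1` (that half of the printed range needs KMV Lemma 3.3 =
[VdK2]/[I-S], typed as the named fact `kmv2000_lemma33_dyadic`, not proved), nothing about general
`(P, Q)`, nothing beyond the diagonal, no claim about Landau–Siegel zeros. The Summit-side assembly of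
the second display at `(X², 1)` on `0 < Δ < 1/2` (exact split + kernel form + corner + this file) is a
Theorems-side helper handed to a prover seat.
«The programme SEARCHES and TYPES; no claim about Landau–Siegel zeros, Theorems 1–2 of
arXiv:2211.02515 or a repaired Margin232 until a kernel theorem says so.»

## References
* [KowalskiMichelVanderKam2000] E. Kowalski, P. Michel, J. VanderKam, J. reine angew. Math. 526
  (2000) 1–34 — Lemma 3.2 (12) p. 8, Lemma 3.3 p. 9, §5 (21)–(23) pp. 12–13.
  [held: paper:doi-10-1515-crll-2000-074 p0008–p0013]
* [KowalskiMichel2000] E. Kowalski, P. Michel, Acta Arith. 94 (2000), §2.4.2 p. 312 (23).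
* [HardyWright2008] Thm. 315 (divisor bound; tree `Literature.NumberTheory.Sieve.DivisorBound`).
-/

noncomputable section

open Finset Polynomial
open scoped Real

namespace Literature.NumberTheory.LFunctions.KMV2000.WeilOffDiag

/-! ### Elementary sums -/

/-- **Tail of a convergent `p`-series by the integral test**: for naturals `1 ≤ a` and real `E < −1`,
`Σ_{a < n ≤ b} n^E ≤ a^{E+1}/(−(E+1))`. [folklore] -/
private theorem sum_Ioc_rpow_le_of_lt {a b : ℕ} (ha : 1 ≤ a) {E : ℝ} (hE : E < -1) :
    ∑ n ∈ Ioc a b, (n : ℝ) ^ E ≤ (a : ℝ) ^ (E + 1) / (-(E + 1)) := by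
  have ha0 : (0 : ℝ) < a := by exact_mod_cast ha
  have hE' : 0 < -(E + 1) := by linarith
  have hapos : 0 ≤ (a : ℝ) ^ (E + 1) / (-(E + 1)) :=
    div_nonneg (Real.rpow_nonneg ha0.le _) hE'.le
  rcases le_or_gt a b with hab | hab
  swap
  · rw [Finset.Ioc_eq_empty (by omega), Finset.sum_empty]; exact hapos
  have hanti : AntitoneOn (fun x : ℝ ↦ x ^ E) (Set.Icc (a : ℝ) b) := by
    intro x hx y hy hxy
    exact Real.rpow_le_rpow_of_nonpos (by linarith [hx.1]) hxy (by linarith)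
  have h1 : ∑ i ∈ Finset.Ico a b, ((i + 1 : ℕ) : ℝ) ^ E ≤ ∫ x in (a : ℝ)..b, x ^ E := by
    have := AntitoneOn.sum_le_integral_Ico hab hanti
    simpa using this
  have h2 : ∑ n ∈ Ioc a b, (n : ℝ) ^ E = ∑ i ∈ Finset.Ico a b, ((i + 1 : ℕ) : ℝ) ^ E := by
    refine (Finset.sum_nbij' (fun i ↦ i + 1) (fun n ↦ n - 1) ?_ ?_ ?_ ?_ ?_).symm
    · intro i hi; rw [Finset.mem_Ico] at hi; rw [Finset.mem_Ioc]; omega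
    · intro n hn; rw [Finset.mem_Ioc] at hn; rw [Finset.mem_Ico]; omega
    · intro i _; omega
    · intro n hn; rw [Finset.mem_Ioc] at hn; omega
    · intro i _; rfl
  rw [h2]
  refine h1.trans ?_
  have hb0 : (0 : ℝ) < b := by exact_mod_cast lt_of_lt_of_le ha hab
  have h0 : (0 : ℝ) ∉ Set.uIcc (a : ℝ) b := by
    rw [Set.uIcc_of_le (by exact_mod_cast hab)]
    intro h
    exact absurd h.1 (not_le.mpr ha0)
  rw [integral_rpow (Or.inr ⟨by linarith, h0⟩)]
  have key : ((b : ℝ) ^ (E + 1) - (a : ℝ) ^ (E + 1)) / (E + 1) =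
      ((a : ℝ) ^ (E + 1) - (b : ℝ) ^ (E + 1)) / (-(E + 1)) := by
    rw [div_neg, ← neg_div, neg_sub]
  rw [key]
  have hb' : 0 ≤ (b : ℝ) ^ (E + 1) := Real.rpow_nonneg hb0.le _
  exact div_le_div_of_nonneg_right (by linarith) hE'.le

/-- `Σ_{1 ≤ n ≤ b} n^E ≤ 1 + 1/(−(E+1))` for `E < −1`. [folklore] -/
private theorem sum_Icc_rpow_le_of_lt (b : ℕ) {E : ℝ} (hE : E < -1) :
    ∑ n ∈ Icc 1 b, (n : ℝ) ^ E ≤ 1 + 1 / (-(E + 1)) := by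
  rcases Nat.eq_zero_or_pos b with rfl | hb
  · simp only [show Icc 1 0 = ∅ by rfl, Finset.sum_empty]
    have : 0 < -(E + 1) := by linarith
    positivity
  have hsplit : Icc 1 b = insert 1 (Ioc 1 b) := by
    ext n; simp only [Finset.mem_Icc, Finset.mem_insert, Finset.mem_Ioc]; omega
  rw [hsplit, Finset.sum_insert (by simp)]
  simp only [Nat.cast_one, Real.one_rpow]
  have h := sum_Ioc_rpow_le_of_lt (b := b) le_rfl hE
  simp only [Nat.cast_one, Real.one_rpow] at h
  linarith

/-- For `X ≥ 1`: `X/2 ≤ ⌊X⌋₊`. [folklore] -/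
private theorem half_le_floor {X : ℝ} (hX : 1 ≤ X) : X / 2 ≤ (⌊X⌋₊ : ℝ) := by
  have h1 : (1 : ℝ) ≤ (⌊X⌋₊ : ℝ) := by exact_mod_cast (Nat.one_le_floor_iff X).mpr hX
  have h2 : X < (⌊X⌋₊ : ℝ) + 1 := Nat.lt_floor_add_one X
  by_cases hX2 : X ≤ 2
  · linarith
  · linarith

/-- For `X ≥ 1` and `0 < e ≤ 1/2`: `Σ_{⌊X⌋ < n ≤ b} n^{e−2} ≤ 4·X^{e−1}`. [folklore] -/
private theorem sum_Ioc_floor_rpow_le {e : ℝ} (he0 : 0 < e) (he : e ≤ 1 / 2) {X : ℝ} (hX : 1 ≤ X) (b : ℕ) :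
    ∑ n ∈ Ioc ⌊X⌋₊ b, (n : ℝ) ^ (e - 2) ≤ 4 * X ^ (e - 1) := by
  have hX0 : 0 < X := by linarith
  have hfl : 1 ≤ ⌊X⌋₊ := (Nat.one_le_floor_iff X).mpr hX
  have h := sum_Ioc_rpow_le_of_lt (b := b) hfl (E := e - 2) (by linarith)
  have hE : e - 2 + 1 = e - 1 := by ring
  rw [hE] at h
  refine h.trans ?_
  have hden : (1 : ℝ) / 2 ≤ -(e - 1) := by linarith
  have hfloor : (⌊X⌋₊ : ℝ) ^ (e - 1) ≤ (X / 2) ^ (e - 1) :=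
    Real.rpow_le_rpow_of_nonpos (by positivity) (half_le_floor hX) (by linarith)
  have hhalf : (X / 2) ^ (e - 1) ≤ 2 * X ^ (e - 1) := by
    rw [Real.div_rpow hX0.le zero_le_two]
    have h2 : (1 : ℝ) / 2 ≤ (2 : ℝ) ^ (e - 1) := by
      have : (2 : ℝ) ^ (-(1 : ℝ)) ≤ (2 : ℝ) ^ (e - 1) :=
        Real.rpow_le_rpow_of_exponent_le one_le_two (by linarith)
      rw [Real.rpow_neg_one] at this
      simpa using this
    rw [div_le_iff₀ (by positivity)]
    have hx : 0 ≤ X ^ (e - 1) := Real.rpow_nonneg hX0.le _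
    nlinarith
  have hnum : 0 ≤ (⌊X⌋₊ : ℝ) ^ (e - 1) := Real.rpow_nonneg (by positivity) _
  calc (⌊X⌋₊ : ℝ) ^ (e - 1) / (-(e - 1))
      ≤ (⌊X⌋₊ : ℝ) ^ (e - 1) / (1 / 2) := div_le_div_of_nonneg_left hnum (by norm_num) hden
    _ = 2 * (⌊X⌋₊ : ℝ) ^ (e - 1) := by ring
    _ ≤ 2 * (2 * X ^ (e - 1)) := by nlinarith
    _ = 4 * X ^ (e - 1) := by ring

/-! ### The two-dimensional weight sum `Σ (n₁n₂)^e W(n₁n₂/Q) ≪ Q^{1+e}(1 + log Q)` -/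

/-- Inner sum, long range (`X ≥ 1`): `Σ_{1 ≤ n ≤ b} n^e W(n/X) ≤ 193·X^{1+e}` for `0 < e ≤ 1/2`
(`W ≤ 1` for `n ≤ X`, `W(y) ≤ 48/y²` for `n > X`). [cite: KowalskiMichelVanderKam2000, (22) p. 12 (decay of W) — derivation] -/
theorem inner_le_of_one_le {e : ℝ} (he0 : 0 < e) (he : e ≤ 1 / 2) {X : ℝ} (hX : 1 ≤ X) (b : ℕ) :
    ∑ n ∈ Icc 1 b, (n : ℝ) ^ e * cutoffW ((n : ℝ) / X) ≤ 193 * X ^ (1 + e) := by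
  have hX0 : 0 < X := by linarith
  rw [← Finset.sum_filter_add_sum_filter_not (Icc 1 b) (fun n : ℕ ↦ n ≤ ⌊X⌋₊)]
  -- part 1: `n ≤ ⌊X⌋`
  have h1 : ∑ n ∈ (Icc 1 b).filter (fun n : ℕ ↦ n ≤ ⌊X⌋₊), (n : ℝ) ^ e * cutoffW ((n : ℝ) / X)
      ≤ X ^ (1 + e) := by
    have hterm : ∀ n ∈ (Icc 1 b).filter (fun n : ℕ ↦ n ≤ ⌊X⌋₊),
        (n : ℝ) ^ e * cutoffW ((n : ℝ) / X) ≤ X ^ e := by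
      intro n hn
      rw [Finset.mem_filter] at hn
      have hnX : (n : ℝ) ≤ X := (Nat.cast_le.mpr hn.2).trans (Nat.floor_le hX0.le)
      have hne : (n : ℝ) ^ e ≤ X ^ e := Real.rpow_le_rpow (Nat.cast_nonneg _) hnX he0.le
      have hW : cutoffW ((n : ℝ) / X) ≤ 1 := cutoffW_le_one (by positivity)
      calc (n : ℝ) ^ e * cutoffW ((n : ℝ) / X) ≤ X ^ e * 1 :=
            mul_le_mul hne hW (cutoffW_nonneg _) (Real.rpow_nonneg hX0.le _)
        _ = X ^ e := mul_one _
    refine (Finset.sum_le_sum hterm).trans ?_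
    rw [Finset.sum_const, nsmul_eq_mul]
    have hcard : (((Icc 1 b).filter (fun n : ℕ ↦ n ≤ ⌊X⌋₊)).card : ℝ) ≤ X := by
      have hsub : (Icc 1 b).filter (fun n : ℕ ↦ n ≤ ⌊X⌋₊) ⊆ Icc 1 ⌊X⌋₊ := by
        intro n hn
        rw [Finset.mem_filter, Finset.mem_Icc] at hn
        rw [Finset.mem_Icc]; exact ⟨hn.1.1, hn.2⟩
      calc (((Icc 1 b).filter (fun n : ℕ ↦ n ≤ ⌊X⌋₊)).card : ℝ) ≤ ((Icc 1 ⌊X⌋₊).card : ℝ) := by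
            exact_mod_cast Finset.card_le_card hsub
        _ = ⌊X⌋₊ := by simp
        _ ≤ X := Nat.floor_le hX0.le
    calc (((Icc 1 b).filter (fun n : ℕ ↦ n ≤ ⌊X⌋₊)).card : ℝ) * X ^ e ≤ X * X ^ e :=
          mul_le_mul_of_nonneg_right hcard (Real.rpow_nonneg hX0.le _)
      _ = X ^ (1 + e) := by rw [Real.rpow_add hX0, Real.rpow_one]
  -- part 2: `n > ⌊X⌋`
  have h2 : ∑ n ∈ (Icc 1 b).filter (fun n : ℕ ↦ ¬ n ≤ ⌊X⌋₊), (n : ℝ) ^ e * cutoffW ((n : ℝ) / X)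
      ≤ 192 * X ^ (1 + e) := by
    have hterm : ∀ n ∈ (Icc 1 b).filter (fun n : ℕ ↦ ¬ n ≤ ⌊X⌋₊),
        (n : ℝ) ^ e * cutoffW ((n : ℝ) / X) ≤ 48 * X ^ 2 * (n : ℝ) ^ (e - 2) := by
      intro n hn
      rw [Finset.mem_filter, not_le] at hn
      have hXn : X < n := Nat.lt_of_floor_lt hn.2
      have hn0 : (0 : ℝ) < n := hX0.trans hXn
      have hy : 0 < (n : ℝ) / X := by positivity
      have hW : cutoffW ((n : ℝ) / X) ≤ 48 / ((n : ℝ) / X) ^ 2 := cutoffW_le_div_sq hy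
      calc (n : ℝ) ^ e * cutoffW ((n : ℝ) / X) ≤ (n : ℝ) ^ e * (48 / ((n : ℝ) / X) ^ 2) :=
            mul_le_mul_of_nonneg_left hW (Real.rpow_nonneg hn0.le _)
        _ = 48 * X ^ 2 * ((n : ℝ) ^ e / (n : ℝ) ^ (2 : ℝ)) := by
            rw [Real.rpow_two]; field_simp
        _ = 48 * X ^ 2 * (n : ℝ) ^ (e - 2) := by rw [← Real.rpow_sub hn0]
    refine (Finset.sum_le_sum hterm).trans ?_
    rw [← Finset.mul_sum]
    have hsub : (Icc 1 b).filter (fun n : ℕ ↦ ¬ n ≤ ⌊X⌋₊) ⊆ Ioc ⌊X⌋₊ b := by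
      intro n hn
      rw [Finset.mem_filter, Finset.mem_Icc, not_le] at hn
      rw [Finset.mem_Ioc]; exact ⟨hn.2, hn.1.2⟩
    have hle : ∑ n ∈ (Icc 1 b).filter (fun n : ℕ ↦ ¬ n ≤ ⌊X⌋₊), (n : ℝ) ^ (e - 2) ≤
        ∑ n ∈ Ioc ⌊X⌋₊ b, (n : ℝ) ^ (e - 2) :=
      Finset.sum_le_sum_of_subset_of_nonneg hsub fun n _ _ ↦ Real.rpow_nonneg (Nat.cast_nonneg _) _
    have htail := sum_Ioc_floor_rpow_le he0 he hX b
    calc 48 * X ^ 2 * ∑ n ∈ (Icc 1 b).filter (fun n : ℕ ↦ ¬ n ≤ ⌊X⌋₊), (n : ℝ) ^ (e - 2)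
        ≤ 48 * X ^ 2 * (4 * X ^ (e - 1)) :=
          mul_le_mul_of_nonneg_left (hle.trans htail) (by positivity)
      _ = 192 * (X ^ 2 * X ^ (e - 1)) := by ring
      _ = 192 * X ^ (1 + e) := by
          rw [show (1 + e) = (2 : ℝ) + (e - 1) by ring, Real.rpow_add hX0, Real.rpow_two]
  linarith

/-- Inner sum, short range (`0 < X ≤ 1` — or any `X > 0`): `Σ_{1 ≤ n ≤ b} n^e W(n/X) ≤ 144·X²`
for `e ≤ 1/2` (`W(y) ≤ 48/y²` throughout). [cite: KowalskiMichelVanderKam2000, (22) p. 12 (decay of W) — derivation] -/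
theorem inner_le_sq {e : ℝ} (he : e ≤ 1 / 2) {X : ℝ} (hX0 : 0 < X) (b : ℕ) :
    ∑ n ∈ Icc 1 b, (n : ℝ) ^ e * cutoffW ((n : ℝ) / X) ≤ 144 * X ^ 2 := by
  have hterm : ∀ n ∈ Icc 1 b, (n : ℝ) ^ e * cutoffW ((n : ℝ) / X) ≤
      48 * X ^ 2 * (n : ℝ) ^ (e - 2) := by
    intro n hn
    rw [Finset.mem_Icc] at hn
    have hn0 : (0 : ℝ) < n := by exact_mod_cast hn.1
    have hy : 0 < (n : ℝ) / X := by positivity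
    have hW : cutoffW ((n : ℝ) / X) ≤ 48 / ((n : ℝ) / X) ^ 2 := cutoffW_le_div_sq hy
    calc (n : ℝ) ^ e * cutoffW ((n : ℝ) / X) ≤ (n : ℝ) ^ e * (48 / ((n : ℝ) / X) ^ 2) :=
          mul_le_mul_of_nonneg_left hW (Real.rpow_nonneg hn0.le _)
      _ = 48 * X ^ 2 * ((n : ℝ) ^ e / (n : ℝ) ^ (2 : ℝ)) := by
          rw [Real.rpow_two]; field_simp
      _ = 48 * X ^ 2 * (n : ℝ) ^ (e - 2) := by rw [← Real.rpow_sub hn0]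
  refine (Finset.sum_le_sum hterm).trans ?_
  rw [← Finset.mul_sum]
  have hs := sum_Icc_rpow_le_of_lt b (E := e - 2) (by linarith)
  have h3 : 1 + 1 / (-(e - 2 + 1)) ≤ 3 := by
    have h1e : -(e - 2 + 1) = 1 - e := by ring
    rw [h1e]
    have : 1 / (1 - e) ≤ 2 := by
      rw [div_le_iff₀ (by linarith)]; linarith
    linarith
  calc 48 * X ^ 2 * ∑ n ∈ Icc 1 b, (n : ℝ) ^ (e - 2) ≤ 48 * X ^ 2 * 3 :=
        mul_le_mul_of_nonneg_left (hs.trans h3) (by positivity)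
    _ = 144 * X ^ 2 := by ring

/-- `Σ_{1 ≤ n ≤ N} 1/n ≤ 1 + log N`. [folklore] -/
private theorem sum_Icc_inv_le_one_add_log (N : ℕ) : ∑ n ∈ Icc 1 N, (n : ℝ)⁻¹ ≤ 1 + Real.log N := by
  have h := harmonic_le_one_add_log N
  rw [harmonic_eq_sum_Icc] at h
  push_cast at h
  exact h

/-- **The box sum**: for `Q ≥ 1`, `0 < e ≤ 1/2` and all `A, B`,
`Σ_{n₁ ≤ A} Σ_{n₂ ≤ B} (n₁n₂)^e W(n₁n₂/Q) ≤ 769·(1 + log Q)·Q^{1+e}`.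
[cite: KowalskiMichelVanderKam2000, (22) p. 12 (decay of W) — derivation] -/
theorem sum_box_le {e : ℝ} (he0 : 0 < e) (he : e ≤ 1 / 2) {Q : ℝ} (hQ : 1 ≤ Q) (A B : ℕ) :
    ∑ n₁ ∈ Icc 1 A, ∑ n₂ ∈ Icc 1 B, ((n₁ : ℝ) * n₂) ^ e * cutoffW ((n₁ : ℝ) * n₂ / Q) ≤
      769 * (1 + Real.log Q) * Q ^ (1 + e) := by
  have hQ0 : 0 < Q := by linarith
  have hlog : 0 ≤ Real.log Q := Real.log_nonneg hQ
  have hQe : 0 ≤ Q ^ (1 + e) := Real.rpow_nonneg hQ0.le _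
  have hinner : ∀ n₁ ∈ Icc 1 A, ∑ n₂ ∈ Icc 1 B, ((n₁ : ℝ) * n₂) ^ e * cutoffW ((n₁ : ℝ) * n₂ / Q) =
      (n₁ : ℝ) ^ e * ∑ n₂ ∈ Icc 1 B, (n₂ : ℝ) ^ e * cutoffW ((n₂ : ℝ) / (Q / n₁)) := by
    intro n₁ hn₁
    rw [Finset.mem_Icc] at hn₁
    have h0 : (0 : ℝ) < n₁ := by exact_mod_cast hn₁.1
    rw [Finset.mul_sum]
    refine Finset.sum_congr rfl fun n₂ _ ↦ ?_
    rw [Real.mul_rpow h0.le (Nat.cast_nonneg _)]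
    have : (n₁ : ℝ) * n₂ / Q = (n₂ : ℝ) / (Q / n₁) := by
      field_simp
    rw [this]; ring
  rw [Finset.sum_congr rfl hinner,
    ← Finset.sum_filter_add_sum_filter_not (Icc 1 A) (fun n : ℕ ↦ n ≤ ⌊Q⌋₊)]
  -- part 1: `n₁ ≤ Q`
  have h1 : ∑ n₁ ∈ (Icc 1 A).filter (fun n : ℕ ↦ n ≤ ⌊Q⌋₊),
      (n₁ : ℝ) ^ e * ∑ n₂ ∈ Icc 1 B, (n₂ : ℝ) ^ e * cutoffW ((n₂ : ℝ) / (Q / n₁)) ≤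
      193 * (1 + Real.log Q) * Q ^ (1 + e) := by
    have hterm : ∀ n₁ ∈ (Icc 1 A).filter (fun n : ℕ ↦ n ≤ ⌊Q⌋₊),
        (n₁ : ℝ) ^ e * ∑ n₂ ∈ Icc 1 B, (n₂ : ℝ) ^ e * cutoffW ((n₂ : ℝ) / (Q / n₁)) ≤
          193 * Q ^ (1 + e) * (n₁ : ℝ)⁻¹ := by
      intro n₁ hn
      rw [Finset.mem_filter, Finset.mem_Icc] at hn
      have h0 : (0 : ℝ) < n₁ := by exact_mod_cast hn.1.1
      have hnQ : (n₁ : ℝ) ≤ Q := (Nat.cast_le.mpr hn.2).trans (Nat.floor_le hQ0.le)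
      have hX : 1 ≤ Q / n₁ := by rw [le_div_iff₀ h0]; linarith
      have hin := inner_le_of_one_le he0 he hX B
      calc (n₁ : ℝ) ^ e * ∑ n₂ ∈ Icc 1 B, (n₂ : ℝ) ^ e * cutoffW ((n₂ : ℝ) / (Q / n₁))
          ≤ (n₁ : ℝ) ^ e * (193 * (Q / n₁) ^ (1 + e)) :=
            mul_le_mul_of_nonneg_left hin (Real.rpow_nonneg h0.le _)
        _ = 193 * Q ^ (1 + e) * (n₁ : ℝ)⁻¹ := by
            rw [Real.div_rpow hQ0.le h0.le, Real.rpow_add h0, Real.rpow_one]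
            have hne : (n₁ : ℝ) ^ e ≠ 0 := (Real.rpow_pos_of_pos h0 e).ne'
            field_simp
    refine (Finset.sum_le_sum hterm).trans ?_
    rw [← Finset.mul_sum]
    have hsub : (Icc 1 A).filter (fun n : ℕ ↦ n ≤ ⌊Q⌋₊) ⊆ Icc 1 ⌊Q⌋₊ := by
      intro n hn
      rw [Finset.mem_filter, Finset.mem_Icc] at hn
      rw [Finset.mem_Icc]; exact ⟨hn.1.1, hn.2⟩
    have hharm : ∑ n ∈ Icc 1 ⌊Q⌋₊, (n : ℝ)⁻¹ ≤ 1 + Real.log Q := by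
      refine (sum_Icc_inv_le_one_add_log ⌊Q⌋₊).trans ?_
      have hfl : (1 : ℝ) ≤ ⌊Q⌋₊ := by exact_mod_cast (Nat.one_le_floor_iff Q).mpr hQ
      have := Real.log_le_log (by linarith) (Nat.floor_le hQ0.le)
      linarith
    have hle : ∑ n ∈ (Icc 1 A).filter (fun n : ℕ ↦ n ≤ ⌊Q⌋₊), (n : ℝ)⁻¹ ≤ 1 + Real.log Q :=
      (Finset.sum_le_sum_of_subset_of_nonneg hsub fun n _ _ ↦ by positivity).trans hharm
    calc 193 * Q ^ (1 + e) * ∑ n ∈ (Icc 1 A).filter (fun n : ℕ ↦ n ≤ ⌊Q⌋₊), (n : ℝ)⁻¹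
        ≤ 193 * Q ^ (1 + e) * (1 + Real.log Q) := mul_le_mul_of_nonneg_left hle (by positivity)
      _ = 193 * (1 + Real.log Q) * Q ^ (1 + e) := by ring
  -- part 2: `n₁ > Q`
  have h2 : ∑ n₁ ∈ (Icc 1 A).filter (fun n : ℕ ↦ ¬ n ≤ ⌊Q⌋₊),
      (n₁ : ℝ) ^ e * ∑ n₂ ∈ Icc 1 B, (n₂ : ℝ) ^ e * cutoffW ((n₂ : ℝ) / (Q / n₁)) ≤
      576 * Q ^ (1 + e) := by
    have hterm : ∀ n₁ ∈ (Icc 1 A).filter (fun n : ℕ ↦ ¬ n ≤ ⌊Q⌋₊),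
        (n₁ : ℝ) ^ e * ∑ n₂ ∈ Icc 1 B, (n₂ : ℝ) ^ e * cutoffW ((n₂ : ℝ) / (Q / n₁)) ≤
          144 * Q ^ 2 * (n₁ : ℝ) ^ (e - 2) := by
      intro n₁ hn
      rw [Finset.mem_filter, not_le] at hn
      have hQn : Q < n₁ := Nat.lt_of_floor_lt hn.2
      have h0 : (0 : ℝ) < n₁ := hQ0.trans hQn
      have hX0 : 0 < Q / n₁ := by positivity
      have hin := inner_le_sq he hX0 B
      calc (n₁ : ℝ) ^ e * ∑ n₂ ∈ Icc 1 B, (n₂ : ℝ) ^ e * cutoffW ((n₂ : ℝ) / (Q / n₁))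
          ≤ (n₁ : ℝ) ^ e * (144 * (Q / n₁) ^ 2) :=
            mul_le_mul_of_nonneg_left hin (Real.rpow_nonneg h0.le _)
        _ = 144 * Q ^ 2 * ((n₁ : ℝ) ^ e / (n₁ : ℝ) ^ (2 : ℝ)) := by
            rw [Real.rpow_two]; field_simp
        _ = 144 * Q ^ 2 * (n₁ : ℝ) ^ (e - 2) := by rw [← Real.rpow_sub h0]
    refine (Finset.sum_le_sum hterm).trans ?_
    rw [← Finset.mul_sum]
    have hsub : (Icc 1 A).filter (fun n : ℕ ↦ ¬ n ≤ ⌊Q⌋₊) ⊆ Ioc ⌊Q⌋₊ A := by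
      intro n hn
      rw [Finset.mem_filter, Finset.mem_Icc, not_le] at hn
      rw [Finset.mem_Ioc]; exact ⟨hn.2, hn.1.2⟩
    have hle : ∑ n ∈ (Icc 1 A).filter (fun n : ℕ ↦ ¬ n ≤ ⌊Q⌋₊), (n : ℝ) ^ (e - 2) ≤
        ∑ n ∈ Ioc ⌊Q⌋₊ A, (n : ℝ) ^ (e - 2) :=
      Finset.sum_le_sum_of_subset_of_nonneg hsub fun n _ _ ↦ Real.rpow_nonneg (Nat.cast_nonneg _) _
    have htail := sum_Ioc_floor_rpow_le he0 he hQ A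
    calc 144 * Q ^ 2 * ∑ n ∈ (Icc 1 A).filter (fun n : ℕ ↦ ¬ n ≤ ⌊Q⌋₊), (n : ℝ) ^ (e - 2)
        ≤ 144 * Q ^ 2 * (4 * Q ^ (e - 1)) :=
          mul_le_mul_of_nonneg_left (hle.trans htail) (by positivity)
      _ = 576 * (Q ^ 2 * Q ^ (e - 1)) := by ring
      _ = 576 * Q ^ (1 + e) := by
          rw [show (1 + e) = (2 : ℝ) + (e - 1) by ring, Real.rpow_add hQ0, Real.rpow_two]
  nlinarith

/-- **Lemma A (the generic weight, any finite set of pairs).** For `Q ≥ 1`, `0 < e ≤ 1/2` and every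
finite `s ⊆ ℕ × ℕ`: `Σ_{(n₁,n₂) ∈ s} (n₁n₂)^e W(n₁n₂/Q) ≤ 769·(1 + log Q)·Q^{1+e}` (terms with a zero
coordinate vanish). [cite: KowalskiMichelVanderKam2000, (22) p. 12 (decay of W) — derivation] -/
theorem sum_weightA_le {e : ℝ} (he0 : 0 < e) (he : e ≤ 1 / 2) {Q : ℝ} (hQ : 1 ≤ Q)
    (s : Finset (ℕ × ℕ)) :
    ∑ n ∈ s, ((n.1 : ℝ) * n.2) ^ e * cutoffW ((n.1 : ℝ) * n.2 / Q) ≤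
      769 * (1 + Real.log Q) * Q ^ (1 + e) := by
  have hnonneg : ∀ n : ℕ × ℕ, 0 ≤ ((n.1 : ℝ) * n.2) ^ e * cutoffW ((n.1 : ℝ) * n.2 / Q) :=
    fun n ↦ mul_nonneg (Real.rpow_nonneg (by positivity) _) (cutoffW_nonneg _)
  -- drop the pairs with a zero coordinate (their terms vanish)
  have hzero : ∀ n ∈ s, ((n.1 : ℝ) * n.2) ^ e * cutoffW ((n.1 : ℝ) * n.2 / Q) ≠ 0 →
      1 ≤ n.1 ∧ 1 ≤ n.2 := by
    intro n _ hne
    by_contra hcon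
    apply hne
    rw [not_and_or, not_le, not_le, Nat.lt_one_iff, Nat.lt_one_iff] at hcon
    rcases hcon with h | h
    · simp [h, Real.zero_rpow he0.ne']
    · simp [h, Real.zero_rpow he0.ne']
  rw [← Finset.sum_filter_of_ne hzero]
  have hsub : s.filter (fun n : ℕ × ℕ ↦ 1 ≤ n.1 ∧ 1 ≤ n.2) ⊆
      Icc 1 (s.sup Prod.fst) ×ˢ Icc 1 (s.sup Prod.snd) := by
    intro n hn
    rw [Finset.mem_filter] at hn
    rw [Finset.mem_product, Finset.mem_Icc, Finset.mem_Icc]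
    exact ⟨⟨hn.2.1, Finset.le_sup (f := Prod.fst) hn.1⟩, ⟨hn.2.2, Finset.le_sup (f := Prod.snd) hn.1⟩⟩
  refine (Finset.sum_le_sum_of_subset_of_nonneg hsub fun n _ _ ↦ hnonneg n).trans ?_
  rw [Finset.sum_product]
  exact sum_box_le he0 he hQ _ _

/-- **Lemma B (pairs of multiples of the level).** For `q ≥ 1`, `Q > 0` and every finite
`s ⊆ ℕ × ℕ`: `Σ_{(n₁,n₂) ∈ s, q ∣ n₁, q ∣ n₂} (n₁n₂)^{1/2} W(n₁n₂/Q) ≤ 48·Q²·(q^{−3/2}·Σ_k k^{−3/2})²`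
(`W(y) ≤ 48/y²`). [cite: KowalskiMichelVanderKam2000, (22) p. 12 (decay of W) — derivation] -/
theorem sum_weightB_le {q : ℕ} (hq : 1 ≤ q) {Q : ℝ} (hQ : 0 < Q) (s : Finset (ℕ × ℕ)) :
    ∑ n ∈ s, (if q ∣ n.1 ∧ q ∣ n.2 then
        ((n.1 : ℝ) * n.2) ^ (1 / 2 : ℝ) * cutoffW ((n.1 : ℝ) * n.2 / Q) else 0) ≤
      48 * Q ^ 2 * ((q : ℝ) ^ (-(3 / 2 : ℝ)) * ∑' k : ℕ, (k : ℝ) ^ (-(3 / 2 : ℝ))) ^ 2 := by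
  have hq0 : (0 : ℝ) < q := by exact_mod_cast hq
  set Z : ℝ := ∑' k : ℕ, (k : ℝ) ^ (-(3 / 2 : ℝ)) with hZ
  have hZs : Summable (fun k : ℕ ↦ (k : ℝ) ^ (-(3 / 2 : ℝ))) :=
    Real.summable_nat_rpow.mpr (by norm_num)
  -- the one-variable majorant
  set a : ℕ → ℝ := fun n ↦ if q ∣ n then (n : ℝ) ^ (-(3 / 2 : ℝ)) else 0 with ha
  have ha0 : ∀ n, 0 ≤ a n := fun n ↦ by
    simp only [ha]; split_ifs
    · exact Real.rpow_nonneg (Nat.cast_nonneg _) _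
    · exact le_rfl
  have hasum : ∀ S : Finset ℕ, ∑ n ∈ S, a n ≤ (q : ℝ) ^ (-(3 / 2 : ℝ)) * Z := by
    intro S
    have hne : ∀ n ∈ S, a n ≠ 0 → q ∣ n := by
      intro n _ hne
      by_contra h; exact hne (by simp [ha, h])
    rw [← Finset.sum_filter_of_ne hne]
    have hinj : Set.InjOn (fun n : ℕ ↦ n / q) ↑(S.filter (fun n : ℕ ↦ q ∣ n)) := by
      intro x hx y hy hxy
      rw [Finset.coe_filter, Set.mem_setOf_eq] at hx hy
      have := congrArg (fun t ↦ q * t) hxy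
      simp only at this
      rwa [Nat.mul_div_cancel' hx.2, Nat.mul_div_cancel' hy.2] at this
    have hre : ∑ n ∈ S.filter (fun n : ℕ ↦ q ∣ n), a n =
        ∑ k ∈ (S.filter (fun n : ℕ ↦ q ∣ n)).image (fun n : ℕ ↦ n / q),
          ((q : ℝ) * k) ^ (-(3 / 2 : ℝ)) := by
      rw [Finset.sum_image hinj]
      refine Finset.sum_congr rfl fun n hn ↦ ?_
      rw [Finset.mem_filter] at hn
      have hcast : ((q : ℝ) * ((n / q : ℕ) : ℝ)) = (n : ℝ) := by
        rw [← Nat.cast_mul, Nat.mul_div_cancel' hn.2]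
      simp only [ha, if_pos hn.2, hcast]
    rw [hre]
    have hmul : ∀ k : ℕ, ((q : ℝ) * k) ^ (-(3 / 2 : ℝ)) =
        (q : ℝ) ^ (-(3 / 2 : ℝ)) * (k : ℝ) ^ (-(3 / 2 : ℝ)) :=
      fun k ↦ Real.mul_rpow hq0.le (Nat.cast_nonneg _)
    simp_rw [hmul]
    rw [← Finset.mul_sum]
    refine mul_le_mul_of_nonneg_left ?_ (Real.rpow_nonneg hq0.le _)
    exact hZs.sum_le_tsum _ (fun k _ ↦ Real.rpow_nonneg (Nat.cast_nonneg _) _)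
  -- termwise comparison with `48 Q² a(n₁) a(n₂)`
  have hterm : ∀ n : ℕ × ℕ, (if q ∣ n.1 ∧ q ∣ n.2 then
      ((n.1 : ℝ) * n.2) ^ (1 / 2 : ℝ) * cutoffW ((n.1 : ℝ) * n.2 / Q) else 0) ≤
      48 * Q ^ 2 * (a n.1 * a n.2) := by
    intro n
    by_cases hdvd : q ∣ n.1 ∧ q ∣ n.2
    · rw [if_pos hdvd]
      have ha1 : a n.1 = (n.1 : ℝ) ^ (-(3 / 2 : ℝ)) := by simp [ha, hdvd.1]
      have ha2 : a n.2 = (n.2 : ℝ) ^ (-(3 / 2 : ℝ)) := by simp [ha, hdvd.2]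
      rw [ha1, ha2]
      rcases Nat.eq_zero_or_pos n.1 with h1 | h1
      · simp [h1, Real.zero_rpow (by norm_num : (-(3 / 2 : ℝ)) ≠ 0)]
      rcases Nat.eq_zero_or_pos n.2 with h2 | h2
      · simp [h2, Real.zero_rpow (by norm_num : (-(3 / 2 : ℝ)) ≠ 0)]
      have hx : (0 : ℝ) < (n.1 : ℝ) * n.2 := by positivity
      have hy : 0 < (n.1 : ℝ) * n.2 / Q := by positivity
      have hW : cutoffW ((n.1 : ℝ) * n.2 / Q) ≤ 48 / ((n.1 : ℝ) * n.2 / Q) ^ 2 :=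
        cutoffW_le_div_sq hy
      calc ((n.1 : ℝ) * n.2) ^ (1 / 2 : ℝ) * cutoffW ((n.1 : ℝ) * n.2 / Q)
          ≤ ((n.1 : ℝ) * n.2) ^ (1 / 2 : ℝ) * (48 / ((n.1 : ℝ) * n.2 / Q) ^ 2) :=
            mul_le_mul_of_nonneg_left hW (Real.rpow_nonneg hx.le _)
        _ = 48 * Q ^ 2 * (((n.1 : ℝ) * n.2) ^ (1 / 2 : ℝ) / ((n.1 : ℝ) * n.2) ^ (2 : ℝ)) := by
            rw [Real.rpow_two]; field_simp
        _ = 48 * Q ^ 2 * ((n.1 : ℝ) * n.2) ^ (-(3 / 2 : ℝ)) := by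
            rw [← Real.rpow_sub hx]; norm_num
        _ = 48 * Q ^ 2 * ((n.1 : ℝ) ^ (-(3 / 2 : ℝ)) * (n.2 : ℝ) ^ (-(3 / 2 : ℝ))) := by
            rw [Real.mul_rpow (Nat.cast_nonneg _) (Nat.cast_nonneg _)]
    · rw [if_neg hdvd]
      exact mul_nonneg (by positivity) (mul_nonneg (ha0 _) (ha0 _))
  refine (Finset.sum_le_sum fun n _ ↦ hterm n).trans ?_
  rw [← Finset.mul_sum]
  -- bound the product sum by a box
  have hsub : s ⊆ Finset.range (s.sup Prod.fst + 1) ×ˢ Finset.range (s.sup Prod.snd + 1) := by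
    intro n hn
    rw [Finset.mem_product, Finset.mem_range, Finset.mem_range]
    exact ⟨Nat.lt_succ_of_le (Finset.le_sup (f := Prod.fst) hn),
      Nat.lt_succ_of_le (Finset.le_sup (f := Prod.snd) hn)⟩
  have hbox : ∑ n ∈ s, a n.1 * a n.2 ≤ ((q : ℝ) ^ (-(3 / 2 : ℝ)) * Z) ^ 2 := by
    refine (Finset.sum_le_sum_of_subset_of_nonneg hsub
      fun n _ _ ↦ mul_nonneg (ha0 _) (ha0 _)).trans ?_
    rw [Finset.sum_product, ← Finset.sum_mul_sum, sq]
    have hS1 := hasum (Finset.range (s.sup Prod.fst + 1))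
    have hS2 := hasum (Finset.range (s.sup Prod.snd + 1))
    have h02 : 0 ≤ ∑ i ∈ Finset.range (s.sup Prod.snd + 1), a i :=
      Finset.sum_nonneg fun i _ ↦ ha0 i
    have hT : 0 ≤ (q : ℝ) ^ (-(3 / 2 : ℝ)) * Z :=
      mul_nonneg (Real.rpow_nonneg hq0.le _)
        (tsum_nonneg fun k ↦ Real.rpow_nonneg (Nat.cast_nonneg _) _)
    exact mul_le_mul hS1 hS2 h02 hT
  exact mul_le_mul_of_nonneg_left hbox (by positivity)

/-! ### Kowalski–Michel's `J_q(a,b)` at EVERY index pair (Weil's bound; no side condition) -/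

/-- **`J_q(a,b)` for all indices**: an absolute `C₀ ≥ 0` with
`‖J_q(a,b)‖ ≤ C₀·√(a,b)·√(ab)·q^{−3/2}` for every prime `q`, every `a ≥ 1` and every `b` — the
termwise Weil bound `KowalskiMichel2000.norm_petKloostermanTerm_le_all` (divisor bound at exponent
`1/4`) summed over `r` (`Σ r^{−5/4} < ∞`). Worse than (23) by `√(a,b)` but valid when `q ∣ (a,b)`.
[cite: KowalskiMichel2000, §2.4.2 p. 312 (23) (proof: "from Weil's bound … and J₁(x) ≪ x")] -/
theorem norm_petJ_le_gcd :
    ∃ C₀ : ℝ, 0 ≤ C₀ ∧ ∀ (q : ℕ) [NeZero q], q.Prime → ∀ a b : ℕ, 1 ≤ a →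
      ‖KowalskiMichel2000.petJ q a b‖ ≤
        C₀ * Real.sqrt ((a.gcd b : ℕ) : ℝ) * Real.sqrt ((a : ℝ) * b) * (q : ℝ) ^ (-(3 / 2 : ℝ)) := by
  obtain ⟨C, hC1, hC⟩ :=
    Literature.NumberTheory.Sieve.exists_card_divisors_le_mul_rpow' (by norm_num : (0 : ℝ) < 1 / 4)
  have hZs : Summable (fun r : ℕ ↦ (r : ℝ) ^ (-(5 / 4 : ℝ))) :=
    Real.summable_nat_rpow.mpr (by norm_num)
  obtain ⟨Z, hZ⟩ : ∃ Z : ℝ, Z = ∑' r : ℕ, (r : ℝ) ^ (-(5 / 4 : ℝ)) := ⟨_, rfl⟩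
  have hZ0 : 0 ≤ Z := hZ ▸ tsum_nonneg fun r ↦ Real.rpow_nonneg (Nat.cast_nonneg _) _
  have hC0 : 0 ≤ C := zero_le_one.trans hC1
  refine ⟨2 * π * (4 * π * C) * Z, by positivity, fun q _ hq a b ha ↦ ?_⟩
  have hq0 : (0 : ℝ) < q := by exact_mod_cast hq.pos
  have hsum : Summable (fun r : ℕ ↦ ‖KowalskiMichel2000.petKloostermanTerm q a b r‖) :=
    KowalskiMichel2000.summable_norm_petKloostermanTerm_all hq ha
  obtain ⟨A, hA⟩ : ∃ A : ℝ, A = 4 * π * C * Real.sqrt ((a.gcd b : ℕ) : ℝ) *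
      Real.sqrt ((a : ℝ) * b) * (q : ℝ) ^ (-(1 / 2 : ℝ)) := ⟨_, rfl⟩
  have hterm : ∀ r : ℕ, ‖KowalskiMichel2000.petKloostermanTerm q a b r‖ ≤
      A * (r : ℝ) ^ (-(5 / 4 : ℝ)) :=
    fun r ↦ hA ▸ KowalskiMichel2000.norm_petKloostermanTerm_le_all hq ha (fun r ↦ hC r) r
  have htsum : ∑' r : ℕ, ‖KowalskiMichel2000.petKloostermanTerm q a b r‖ ≤ A * Z := by
    calc ∑' r : ℕ, ‖KowalskiMichel2000.petKloostermanTerm q a b r‖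
        ≤ ∑' r : ℕ, A * (r : ℝ) ^ (-(5 / 4 : ℝ)) := Summable.tsum_le_tsum hterm hsum (hZs.mul_left A)
      _ = A * Z := by rw [tsum_mul_left, hZ]
  have hnorm : ‖(2 * π / q : ℂ)‖ = 2 * π / q := by
    rw [norm_div, norm_mul, Complex.norm_real, Complex.norm_natCast, Real.norm_eq_abs,
      abs_of_pos Real.pi_pos, Complex.norm_two]
  have hJ : ‖KowalskiMichel2000.petJ q a b‖ ≤ 2 * π / q * (A * Z) := by
    rw [KowalskiMichel2000.petJ_def, norm_mul, hnorm]
    exact mul_le_mul_of_nonneg_left ((norm_tsum_le_tsum_norm hsum).trans htsum) (by positivity)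
  have hq32 : 2 * π / q * (q : ℝ) ^ (-(1 / 2 : ℝ)) = 2 * π * (q : ℝ) ^ (-(3 / 2 : ℝ)) := by
    rw [div_eq_mul_inv, ← Real.rpow_neg_one, mul_assoc, ← Real.rpow_add hq0]
    norm_num
  calc ‖KowalskiMichel2000.petJ q a b‖ ≤ 2 * π / q * (A * Z) := hJ
    _ = (2 * π / q * (q : ℝ) ^ (-(1 / 2 : ℝ))) * (4 * π * C) * Z *
          Real.sqrt ((a.gcd b : ℕ) : ℝ) * Real.sqrt ((a : ℝ) * b) := by
        rw [hA]; ring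
    _ = 2 * π * (4 * π * C) * Z * Real.sqrt ((a.gcd b : ℕ) : ℝ) * Real.sqrt ((a : ℝ) * b) *
          (q : ℝ) ^ (-(3 / 2 : ℝ)) := by
        rw [hq32]; ring

/-! ### The off-diagonal summand: one divisor pair, then the `(d₁, d₂)`-sum against the AFE weight -/

/-- **One Kloosterman–Bessel value inside `OFF_q(l,m)`.** For `q` prime, `1 ≤ l, m < q`,
`n₁, n₂ ≥ 1`, `d₁ ∣ (l,n₁)`, `d₂ ∣ (m,n₂)`, with `a = l n₁/d₁²`, `b = m n₂/d₂²` (both `≥ 1`):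
`‖J_q(a,b)‖ ≤ C_ε (l m n₁ n₂)^{1/2+ε} q^{−3/2} + 𝟙[q ∣ n₁ ∧ q ∣ n₂]·C₀ (l m n₁ n₂) q^{−3/2}` — the
in-range bound (23) when `q ∤ (a,b)`, and otherwise (which forces `q ∣ n₁`, `q ∣ n₂` since
`l, m < q`) the all-index bound with `√(a,b)√(ab) ≤ ab`.
[cite: KowalskiMichel2000, §2.4.2 p. 312 (23); KowalskiMichelVanderKam2000, Lemma 3.3 p. 9 («using the Weil bound alone») — derivation] -/
theorem norm_petJ_pair_le {ε Cε C₀ : ℝ} (hε : 0 ≤ ε) (hCε0 : 0 ≤ Cε)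
    (hCε : ∀ (q : ℕ) [NeZero q], q.Prime → ∀ m n : ℕ, 1 ≤ m → 1 ≤ n → ¬ (q ∣ m ∧ q ∣ n) →
      ‖KowalskiMichel2000.petJ q m n‖ ≤
        Cε * (((m : ℝ) * n) ^ (1 / 2 + ε)) * (q : ℝ) ^ (-(3 / 2 : ℝ)))
    (hC₀0 : 0 ≤ C₀)
    (hC₀ : ∀ (q : ℕ) [NeZero q], q.Prime → ∀ a b : ℕ, 1 ≤ a →
      ‖KowalskiMichel2000.petJ q a b‖ ≤
        C₀ * Real.sqrt ((a.gcd b : ℕ) : ℝ) * Real.sqrt ((a : ℝ) * b) * (q : ℝ) ^ (-(3 / 2 : ℝ)))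
    {q : ℕ} [NeZero q] (hq : q.Prime) {l m : ℕ} (hl : 1 ≤ l) (hlq : l < q) (hm : 1 ≤ m)
    (hmq : m < q) {n₁ n₂ : ℕ} (hn₁ : 1 ≤ n₁) (hn₂ : 1 ≤ n₂) {d₁ d₂ : ℕ}
    (hd₁ : d₁ ∈ (l.gcd n₁).divisors) (hd₂ : d₂ ∈ (m.gcd n₂).divisors) :
    ‖KowalskiMichel2000.petJ q (l * n₁ / d₁ ^ 2) (m * n₂ / d₂ ^ 2)‖ ≤
      Cε * (((l : ℝ) * m) * ((n₁ : ℝ) * n₂)) ^ (1 / 2 + ε) * (q : ℝ) ^ (-(3 / 2 : ℝ)) +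
        (if q ∣ n₁ ∧ q ∣ n₂ then
          C₀ * (((l : ℝ) * m) * ((n₁ : ℝ) * n₂)) * (q : ℝ) ^ (-(3 / 2 : ℝ)) else 0) := by
  have hq0 : (0 : ℝ) < q := by exact_mod_cast hq.pos
  have hd₁' := Nat.mem_divisors.mp hd₁
  have hd₂' := Nat.mem_divisors.mp hd₂
  have hd₁l : d₁ ∣ l := hd₁'.1.trans (Nat.gcd_dvd_left _ _)
  have hd₁n : d₁ ∣ n₁ := hd₁'.1.trans (Nat.gcd_dvd_right _ _)
  have hd₂m : d₂ ∣ m := hd₂'.1.trans (Nat.gcd_dvd_left _ _)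
  have hd₂n : d₂ ∣ n₂ := hd₂'.1.trans (Nat.gcd_dvd_right _ _)
  have hsq₁ : d₁ ^ 2 ∣ l * n₁ := by rw [sq]; exact Nat.mul_dvd_mul hd₁l hd₁n
  have hsq₂ : d₂ ^ 2 ∣ m * n₂ := by rw [sq]; exact Nat.mul_dvd_mul hd₂m hd₂n
  have hln : 0 < l * n₁ := Nat.mul_pos hl hn₁
  have hmn : 0 < m * n₂ := Nat.mul_pos hm hn₂
  have hd₁0 : 0 < d₁ := Nat.pos_of_mem_divisors hd₁
  have hd₂0 : 0 < d₂ := Nat.pos_of_mem_divisors hd₂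
  have ha1 : 1 ≤ l * n₁ / d₁ ^ 2 := Nat.div_pos (Nat.le_of_dvd hln hsq₁) (pow_pos hd₁0 2)
  have hb1 : 1 ≤ m * n₂ / d₂ ^ 2 := Nat.div_pos (Nat.le_of_dvd hmn hsq₂) (pow_pos hd₂0 2)
  have hab_le : ((l * n₁ / d₁ ^ 2 : ℕ) : ℝ) * ((m * n₂ / d₂ ^ 2 : ℕ) : ℝ) ≤
      ((l : ℝ) * m) * ((n₁ : ℝ) * n₂) := by
    have h : (l * n₁ / d₁ ^ 2) * (m * n₂ / d₂ ^ 2) ≤ (l * n₁) * (m * n₂) :=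
      Nat.mul_le_mul (Nat.div_le_self _ _) (Nat.div_le_self _ _)
    calc ((l * n₁ / d₁ ^ 2 : ℕ) : ℝ) * ((m * n₂ / d₂ ^ 2 : ℕ) : ℝ)
        = (((l * n₁ / d₁ ^ 2) * (m * n₂ / d₂ ^ 2) : ℕ) : ℝ) := by push_cast; ring
      _ ≤ (((l * n₁) * (m * n₂) : ℕ) : ℝ) := by exact_mod_cast h
      _ = ((l : ℝ) * m) * ((n₁ : ℝ) * n₂) := by push_cast; ring
  have hab0 : (0 : ℝ) ≤ ((l * n₁ / d₁ ^ 2 : ℕ) : ℝ) * ((m * n₂ / d₂ ^ 2 : ℕ) : ℝ) := by positivity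
  have hA : Cε * ((((l * n₁ / d₁ ^ 2 : ℕ) : ℝ) * ((m * n₂ / d₂ ^ 2 : ℕ) : ℝ)) ^ (1 / 2 + ε)) *
      (q : ℝ) ^ (-(3 / 2 : ℝ)) ≤
      Cε * (((l : ℝ) * m) * ((n₁ : ℝ) * n₂)) ^ (1 / 2 + ε) * (q : ℝ) ^ (-(3 / 2 : ℝ)) := by
    have h := Real.rpow_le_rpow hab0 hab_le (by linarith : (0 : ℝ) ≤ 1 / 2 + ε)
    exact mul_le_mul_of_nonneg_right (mul_le_mul_of_nonneg_left h hCε0) (Real.rpow_nonneg hq0.le _)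
  have hB0 : 0 ≤ (if q ∣ n₁ ∧ q ∣ n₂ then
      C₀ * (((l : ℝ) * m) * ((n₁ : ℝ) * n₂)) * (q : ℝ) ^ (-(3 / 2 : ℝ)) else 0) := by
    split_ifs
    · positivity
    · exact le_rfl
  by_cases hdiv : q ∣ l * n₁ / d₁ ^ 2 ∧ q ∣ m * n₂ / d₂ ^ 2
  · -- `q` divides both arguments: then `q ∣ n₁` and `q ∣ n₂`
    have key : ∀ {k n d : ℕ}, 1 ≤ k → k < q → d ^ 2 ∣ k * n → q ∣ k * n / d ^ 2 → q ∣ n := by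
      intro k n d hk hkq hd hqd
      have h1 : q ∣ k * n := hqd.trans (Nat.div_dvd_of_dvd hd)
      rcases (Nat.Prime.dvd_mul hq).mp h1 with h | h
      · exact absurd (Nat.le_of_dvd hk h) (not_le.mpr hkq)
      · exact h
    have hqn : q ∣ n₁ ∧ q ∣ n₂ := ⟨key hl hlq hsq₁ hdiv.1, key hm hmq hsq₂ hdiv.2⟩
    rw [if_pos hqn]
    have hJ := hC₀ q hq (l * n₁ / d₁ ^ 2) (m * n₂ / d₂ ^ 2) ha1
    have hg : Real.sqrt (((l * n₁ / d₁ ^ 2).gcd (m * n₂ / d₂ ^ 2) : ℕ) : ℝ) *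
        Real.sqrt (((l * n₁ / d₁ ^ 2 : ℕ) : ℝ) * ((m * n₂ / d₂ ^ 2 : ℕ) : ℝ)) ≤
        ((l : ℝ) * m) * ((n₁ : ℝ) * n₂) := by
      have hgle : (((l * n₁ / d₁ ^ 2).gcd (m * n₂ / d₂ ^ 2) : ℕ) : ℝ) ≤
          ((l * n₁ / d₁ ^ 2 : ℕ) : ℝ) * ((m * n₂ / d₂ ^ 2 : ℕ) : ℝ) := by
        have h1 : (l * n₁ / d₁ ^ 2).gcd (m * n₂ / d₂ ^ 2) ≤ l * n₁ / d₁ ^ 2 :=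
          Nat.gcd_le_left _ ha1
        have h2 : l * n₁ / d₁ ^ 2 ≤ (l * n₁ / d₁ ^ 2) * (m * n₂ / d₂ ^ 2) :=
          Nat.le_mul_of_pos_right _ hb1
        exact_mod_cast h1.trans h2
      calc Real.sqrt (((l * n₁ / d₁ ^ 2).gcd (m * n₂ / d₂ ^ 2) : ℕ) : ℝ) *
            Real.sqrt (((l * n₁ / d₁ ^ 2 : ℕ) : ℝ) * ((m * n₂ / d₂ ^ 2 : ℕ) : ℝ))
          ≤ Real.sqrt (((l * n₁ / d₁ ^ 2 : ℕ) : ℝ) * ((m * n₂ / d₂ ^ 2 : ℕ) : ℝ)) *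
            Real.sqrt (((l * n₁ / d₁ ^ 2 : ℕ) : ℝ) * ((m * n₂ / d₂ ^ 2 : ℕ) : ℝ)) :=
            mul_le_mul_of_nonneg_right (Real.sqrt_le_sqrt hgle) (Real.sqrt_nonneg _)
        _ = ((l * n₁ / d₁ ^ 2 : ℕ) : ℝ) * ((m * n₂ / d₂ ^ 2 : ℕ) : ℝ) := Real.mul_self_sqrt hab0
        _ ≤ _ := hab_le
    have hB : C₀ * Real.sqrt (((l * n₁ / d₁ ^ 2).gcd (m * n₂ / d₂ ^ 2) : ℕ) : ℝ) *
        Real.sqrt (((l * n₁ / d₁ ^ 2 : ℕ) : ℝ) * ((m * n₂ / d₂ ^ 2 : ℕ) : ℝ)) *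
        (q : ℝ) ^ (-(3 / 2 : ℝ)) ≤
        C₀ * (((l : ℝ) * m) * ((n₁ : ℝ) * n₂)) * (q : ℝ) ^ (-(3 / 2 : ℝ)) := by
      have h1 := mul_le_mul_of_nonneg_left hg hC₀0
      have h2 := mul_le_mul_of_nonneg_right h1 (Real.rpow_nonneg hq0.le (-(3 / 2 : ℝ)))
      calc _ = C₀ * (Real.sqrt (((l * n₁ / d₁ ^ 2).gcd (m * n₂ / d₂ ^ 2) : ℕ) : ℝ) *
            Real.sqrt (((l * n₁ / d₁ ^ 2 : ℕ) : ℝ) * ((m * n₂ / d₂ ^ 2 : ℕ) : ℝ))) *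
            (q : ℝ) ^ (-(3 / 2 : ℝ)) := by ring
        _ ≤ _ := h2
    have hApos : 0 ≤ Cε * (((l : ℝ) * m) * ((n₁ : ℝ) * n₂)) ^ (1 / 2 + ε) *
        (q : ℝ) ^ (-(3 / 2 : ℝ)) := by positivity
    linarith [hJ, hB]
  · have hJ := hCε q hq (l * n₁ / d₁ ^ 2) (m * n₂ / d₂ ^ 2) ha1 hb1 hdiv
    linarith [hJ, hA, hB0]

/-- **The `n = (n₁,n₂)` summand of `OFF_q(l,m)` in norm** (`q` prime, `1 ≤ l, m < q`):
`‖w_q(n)·Σ_{d₁∣(l,n₁)} Σ_{d₂∣(m,n₂)} J_q(l n₁/d₁², m n₂/d₂²)‖ ≤ τ(l)τ(m) q^{−3/2} ·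
 [C_ε (lm)^{1/2+ε}·(n₁n₂)^ε W(n₁n₂/q̂²) + C₀ lm·𝟙[q∣n₁, q∣n₂] (n₁n₂)^{1/2} W(n₁n₂/q̂²)]`
(`w_q(n) = (n₁n₂)^{−1/2}W(n₁n₂/q̂²)`; vanishes on the axes).
[cite: KowalskiMichelVanderKam2000, (21)–(23) p. 12–13 and Lemma 3.3 p. 9 («using the Weil bound alone») — derivation] -/
theorem norm_offSummand_le {ε Cε C₀ : ℝ} (hε : 0 ≤ ε) (hCε0 : 0 ≤ Cε)
    (hCε : ∀ (q : ℕ) [NeZero q], q.Prime → ∀ m n : ℕ, 1 ≤ m → 1 ≤ n → ¬ (q ∣ m ∧ q ∣ n) →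
      ‖KowalskiMichel2000.petJ q m n‖ ≤
        Cε * (((m : ℝ) * n) ^ (1 / 2 + ε)) * (q : ℝ) ^ (-(3 / 2 : ℝ)))
    (hC₀0 : 0 ≤ C₀)
    (hC₀ : ∀ (q : ℕ) [NeZero q], q.Prime → ∀ a b : ℕ, 1 ≤ a →
      ‖KowalskiMichel2000.petJ q a b‖ ≤
        C₀ * Real.sqrt ((a.gcd b : ℕ) : ℝ) * Real.sqrt ((a : ℝ) * b) * (q : ℝ) ^ (-(3 / 2 : ℝ)))
    {q : ℕ} [NeZero q] (hq : q.Prime) {l m : ℕ} (hl : 1 ≤ l) (hlq : l < q) (hm : 1 ≤ m)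
    (hmq : m < q) (n : ℕ × ℕ) :
    ‖(((((n.1 : ℝ) * n.2) ^ (-(1 / 2 : ℝ)) * cutoffW ((n.1 : ℝ) * n.2 / qhat q ^ 2)) : ℝ) : ℂ) *
        ∑ d₁ ∈ (l.gcd n.1).divisors, ∑ d₂ ∈ (m.gcd n.2).divisors,
          KowalskiMichel2000.petJ q (l * n.1 / d₁ ^ 2) (m * n.2 / d₂ ^ 2)‖ ≤
      ((l.divisors.card * m.divisors.card : ℕ) : ℝ) * (q : ℝ) ^ (-(3 / 2 : ℝ)) *
        (Cε * ((l : ℝ) * m) ^ (1 / 2 + ε) *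
            (((n.1 : ℝ) * n.2) ^ ε * cutoffW ((n.1 : ℝ) * n.2 / qhat q ^ 2)) +
          C₀ * ((l : ℝ) * m) *
            (if q ∣ n.1 ∧ q ∣ n.2 then
              ((n.1 : ℝ) * n.2) ^ (1 / 2 : ℝ) * cutoffW ((n.1 : ℝ) * n.2 / qhat q ^ 2) else 0)) := by
  have hq0 : (0 : ℝ) < q := by exact_mod_cast hq.pos
  have hR : 0 ≤ ((l.divisors.card * m.divisors.card : ℕ) : ℝ) * (q : ℝ) ^ (-(3 / 2 : ℝ)) *
      (Cε * ((l : ℝ) * m) ^ (1 / 2 + ε) *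
          (((n.1 : ℝ) * n.2) ^ ε * cutoffW ((n.1 : ℝ) * n.2 / qhat q ^ 2)) +
        C₀ * ((l : ℝ) * m) *
          (if q ∣ n.1 ∧ q ∣ n.2 then
            ((n.1 : ℝ) * n.2) ^ (1 / 2 : ℝ) * cutoffW ((n.1 : ℝ) * n.2 / qhat q ^ 2) else 0)) := by
    have h1 : 0 ≤ ((n.1 : ℝ) * n.2) ^ ε * cutoffW ((n.1 : ℝ) * n.2 / qhat q ^ 2) :=
      mul_nonneg (Real.rpow_nonneg (by positivity) _) (cutoffW_nonneg _)
    have h2 : 0 ≤ (if q ∣ n.1 ∧ q ∣ n.2 then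
        ((n.1 : ℝ) * n.2) ^ (1 / 2 : ℝ) * cutoffW ((n.1 : ℝ) * n.2 / qhat q ^ 2) else 0) := by
      split_ifs
      · exact mul_nonneg (Real.rpow_nonneg (by positivity) _) (cutoffW_nonneg _)
      · exact le_rfl
    have h3 : 0 ≤ ((l : ℝ) * m) ^ (1 / 2 + ε) := Real.rpow_nonneg (by positivity) _
    positivity
  -- on the axes the weight vanishes
  rcases Nat.eq_zero_or_pos n.1 with h1 | h1
  · have hw : (((n.1 : ℝ) * n.2) ^ (-(1 / 2 : ℝ)) * cutoffW ((n.1 : ℝ) * n.2 / qhat q ^ 2)) = 0 := by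
      simp [h1]
    rw [hw]; simpa using hR
  rcases Nat.eq_zero_or_pos n.2 with h2 | h2
  · have hw : (((n.1 : ℝ) * n.2) ^ (-(1 / 2 : ℝ)) * cutoffW ((n.1 : ℝ) * n.2 / qhat q ^ 2)) = 0 := by
      simp [h2]
    rw [hw]; simpa using hR
  -- the double divisor sum
  have hw0 : 0 ≤ (((n.1 : ℝ) * n.2) ^ (-(1 / 2 : ℝ)) * cutoffW ((n.1 : ℝ) * n.2 / qhat q ^ 2)) :=
    mul_nonneg (Real.rpow_nonneg (by positivity) _) (cutoffW_nonneg _)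
  have hP0 : 0 ≤ Cε * (((l : ℝ) * m) * ((n.1 : ℝ) * n.2)) ^ (1 / 2 + ε) * (q : ℝ) ^ (-(3 / 2 : ℝ)) +
      (if q ∣ n.1 ∧ q ∣ n.2 then
        C₀ * (((l : ℝ) * m) * ((n.1 : ℝ) * n.2)) * (q : ℝ) ^ (-(3 / 2 : ℝ)) else 0) := by
    have : 0 ≤ (if q ∣ n.1 ∧ q ∣ n.2 then
        C₀ * (((l : ℝ) * m) * ((n.1 : ℝ) * n.2)) * (q : ℝ) ^ (-(3 / 2 : ℝ)) else 0) := by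
      split_ifs
      · positivity
      · exact le_rfl
    positivity
  have hsum : ‖∑ d₁ ∈ (l.gcd n.1).divisors, ∑ d₂ ∈ (m.gcd n.2).divisors,
      KowalskiMichel2000.petJ q (l * n.1 / d₁ ^ 2) (m * n.2 / d₂ ^ 2)‖ ≤
      ((l.divisors.card * m.divisors.card : ℕ) : ℝ) *
        (Cε * (((l : ℝ) * m) * ((n.1 : ℝ) * n.2)) ^ (1 / 2 + ε) * (q : ℝ) ^ (-(3 / 2 : ℝ)) +
          (if q ∣ n.1 ∧ q ∣ n.2 then
            C₀ * (((l : ℝ) * m) * ((n.1 : ℝ) * n.2)) * (q : ℝ) ^ (-(3 / 2 : ℝ)) else 0)) := by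
    calc ‖∑ d₁ ∈ (l.gcd n.1).divisors, ∑ d₂ ∈ (m.gcd n.2).divisors,
          KowalskiMichel2000.petJ q (l * n.1 / d₁ ^ 2) (m * n.2 / d₂ ^ 2)‖
        ≤ ∑ d₁ ∈ (l.gcd n.1).divisors, ‖∑ d₂ ∈ (m.gcd n.2).divisors,
            KowalskiMichel2000.petJ q (l * n.1 / d₁ ^ 2) (m * n.2 / d₂ ^ 2)‖ := norm_sum_le _ _
      _ ≤ ∑ d₁ ∈ (l.gcd n.1).divisors, ∑ d₂ ∈ (m.gcd n.2).divisors,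
            ‖KowalskiMichel2000.petJ q (l * n.1 / d₁ ^ 2) (m * n.2 / d₂ ^ 2)‖ :=
          Finset.sum_le_sum fun d₁ _ ↦ norm_sum_le _ _
      _ ≤ ∑ d₁ ∈ (l.gcd n.1).divisors, ∑ d₂ ∈ (m.gcd n.2).divisors,
            (Cε * (((l : ℝ) * m) * ((n.1 : ℝ) * n.2)) ^ (1 / 2 + ε) * (q : ℝ) ^ (-(3 / 2 : ℝ)) +
              (if q ∣ n.1 ∧ q ∣ n.2 then
                C₀ * (((l : ℝ) * m) * ((n.1 : ℝ) * n.2)) * (q : ℝ) ^ (-(3 / 2 : ℝ)) else 0)) :=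
          Finset.sum_le_sum fun d₁ hd₁ ↦ Finset.sum_le_sum fun d₂ hd₂ ↦
            norm_petJ_pair_le hε hCε0 hCε hC₀0 hC₀ hq hl hlq hm hmq h1 h2 hd₁ hd₂
      _ = (((l.gcd n.1).divisors.card * (m.gcd n.2).divisors.card : ℕ) : ℝ) *
            (Cε * (((l : ℝ) * m) * ((n.1 : ℝ) * n.2)) ^ (1 / 2 + ε) * (q : ℝ) ^ (-(3 / 2 : ℝ)) +
              (if q ∣ n.1 ∧ q ∣ n.2 then
                C₀ * (((l : ℝ) * m) * ((n.1 : ℝ) * n.2)) * (q : ℝ) ^ (-(3 / 2 : ℝ)) else 0)) := by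
          rw [Finset.sum_const, Finset.sum_const, smul_smul, nsmul_eq_mul]
      _ ≤ _ := by
          refine mul_le_mul_of_nonneg_right ?_ hP0
          have hc1 : (l.gcd n.1).divisors.card ≤ l.divisors.card :=
            Finset.card_le_card (Nat.divisors_subset_of_dvd (by omega) (Nat.gcd_dvd_left _ _))
          have hc2 : (m.gcd n.2).divisors.card ≤ m.divisors.card :=
            Finset.card_le_card (Nat.divisors_subset_of_dvd (by omega) (Nat.gcd_dvd_left _ _))
          exact_mod_cast Nat.mul_le_mul hc1 hc2
  -- multiply by the weight and redistribute the powers of `n₁n₂`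
  rw [norm_mul, Complex.norm_real, Real.norm_of_nonneg hw0]
  set x : ℝ := (n.1 : ℝ) * n.2 with hx
  have hx0 : 0 < x := by rw [hx]; positivity
  refine (mul_le_mul_of_nonneg_left hsum hw0).trans (le_of_eq ?_)
  have hlm0 : (0 : ℝ) ≤ (l : ℝ) * m := by positivity
  have hx1 : x ^ (-(1 / 2 : ℝ)) * (((l : ℝ) * m) * x) ^ (1 / 2 + ε) =
      ((l : ℝ) * m) ^ (1 / 2 + ε) * x ^ ε := by
    rw [Real.mul_rpow hlm0 hx0.le]
    have : x ^ (-(1 / 2 : ℝ)) * x ^ (1 / 2 + ε) = x ^ ε := by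
      rw [← Real.rpow_add hx0]; norm_num
    calc x ^ (-(1 / 2 : ℝ)) * (((l : ℝ) * m) ^ (1 / 2 + ε) * x ^ (1 / 2 + ε))
        = ((l : ℝ) * m) ^ (1 / 2 + ε) * (x ^ (-(1 / 2 : ℝ)) * x ^ (1 / 2 + ε)) := by ring
      _ = ((l : ℝ) * m) ^ (1 / 2 + ε) * x ^ ε := by rw [this]
  have hx2 : x ^ (-(1 / 2 : ℝ)) * x = x ^ (1 / 2 : ℝ) := by
    conv_lhs => rw [show x ^ (-(1 / 2 : ℝ)) * x = x ^ (-(1 / 2 : ℝ)) * x ^ (1 : ℝ) by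
      rw [Real.rpow_one]]
    rw [← Real.rpow_add hx0]; norm_num
  split_ifs with hqn
  · linear_combination (cutoffW (x / qhat q ^ 2) *
        ((l.divisors.card * m.divisors.card : ℕ) : ℝ) * Cε * (q : ℝ) ^ (-(3 / 2 : ℝ))) * hx1 +
      (cutoffW (x / qhat q ^ 2) * ((l.divisors.card * m.divisors.card : ℕ) : ℝ) * C₀ *
        ((l : ℝ) * m) * (q : ℝ) ^ (-(3 / 2 : ℝ))) * hx2
  · linear_combination (cutoffW (x / qhat q ^ 2) *
        ((l.divisors.card * m.divisors.card : ℕ) : ℝ) * Cε * (q : ℝ) ^ (-(3 / 2 : ℝ))) * hx1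

/-! ### `‖OFF_q(l,m)‖`, and the mollified off-diagonal on the Weil range `Δ < 1/2` -/

/-- **`OFF_q(l,m)` in norm.** For `q` prime with `q̂ ≥ 1`, `1 ≤ l, m < q` and any `0 < ε ≤ 1/2`:
`‖OFF_q(l,m)‖ ≤ 2q̂·τ(l)τ(m)·q^{−3/2}·[C_ε (lm)^{1/2+ε}·769(1 + log q̂²)(q̂²)^{1+ε}
 + C₀ lm·48 q̂⁴ (q^{−3/2} Σ_k k^{−3/2})²]` (termwise `norm_offSummand_le`, summed with Lemmas A and B;
in particular the defining double series of `PeterssonSplit.offDiag` converges absolutely).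
[cite: KowalskiMichelVanderKam2000, Lemma 3.3 p. 9 («using the Weil bound alone gives q^{−1/2+ε}(m₁m₂N₁N₂)^{1/2}») — derivation] -/
theorem norm_offDiag_le {ε Cε C₀ : ℝ} (hε0 : 0 < ε) (hε : ε ≤ 1 / 2) (hCε0 : 0 ≤ Cε)
    (hCε : ∀ (q : ℕ) [NeZero q], q.Prime → ∀ m n : ℕ, 1 ≤ m → 1 ≤ n → ¬ (q ∣ m ∧ q ∣ n) →
      ‖KowalskiMichel2000.petJ q m n‖ ≤
        Cε * (((m : ℝ) * n) ^ (1 / 2 + ε)) * (q : ℝ) ^ (-(3 / 2 : ℝ)))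
    (hC₀0 : 0 ≤ C₀)
    (hC₀ : ∀ (q : ℕ) [NeZero q], q.Prime → ∀ a b : ℕ, 1 ≤ a →
      ‖KowalskiMichel2000.petJ q a b‖ ≤
        C₀ * Real.sqrt ((a.gcd b : ℕ) : ℝ) * Real.sqrt ((a : ℝ) * b) * (q : ℝ) ^ (-(3 / 2 : ℝ)))
    {q : ℕ} [NeZero q] (hq : q.Prime) (hq1 : 1 ≤ qhat q) {l m : ℕ} (hl : 1 ≤ l) (hlq : l < q)
    (hm : 1 ≤ m) (hmq : m < q) :
    ‖(2 * (qhat q : ℂ) * ∑' n : ℕ × ℕ,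
        (((((n.1 : ℝ) * n.2) ^ (-(1 / 2 : ℝ)) * cutoffW ((n.1 : ℝ) * n.2 / qhat q ^ 2)) : ℝ) : ℂ) *
          ∑ d₁ ∈ (l.gcd n.1).divisors, ∑ d₂ ∈ (m.gcd n.2).divisors,
            KowalskiMichel2000.petJ q (l * n.1 / d₁ ^ 2) (m * n.2 / d₂ ^ 2))‖ ≤
      2 * qhat q * (((l.divisors.card * m.divisors.card : ℕ) : ℝ) *
        (q : ℝ) ^ (-(3 / 2 : ℝ)) *
        (Cε * ((l : ℝ) * m) ^ (1 / 2 + ε) *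
            (769 * (1 + Real.log (qhat q ^ 2)) * (qhat q ^ 2) ^ (1 + ε)) +
          C₀ * ((l : ℝ) * m) *
            (48 * (qhat q ^ 2) ^ 2 *
              ((q : ℝ) ^ (-(3 / 2 : ℝ)) * ∑' k : ℕ, (k : ℝ) ^ (-(3 / 2 : ℝ))) ^ 2))) := by
  have hQ0 : 0 < qhat q := lt_of_lt_of_le one_pos hq1
  have hQ1 : 1 ≤ qhat q ^ 2 := by nlinarith
  have hQ2 : 0 < qhat q ^ 2 := by positivity
  set F : ℕ × ℕ → ℂ := fun n ↦ (((((n.1 : ℝ) * n.2) ^ (-(1 / 2 : ℝ)) * cutoffW ((n.1 : ℝ) * n.2 / qhat q ^ 2)) : ℝ) : ℂ) *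
      ∑ d₁ ∈ (l.gcd n.1).divisors, ∑ d₂ ∈ (m.gcd n.2).divisors,
        KowalskiMichel2000.petJ q (l * n.1 / d₁ ^ 2) (m * n.2 / d₂ ^ 2) with hF
  set B : ℝ := ((l.divisors.card * m.divisors.card : ℕ) : ℝ) * (q : ℝ) ^ (-(3 / 2 : ℝ)) *
      (Cε * ((l : ℝ) * m) ^ (1 / 2 + ε) *
          (769 * (1 + Real.log (qhat q ^ 2)) * (qhat q ^ 2) ^ (1 + ε)) +
        C₀ * ((l : ℝ) * m) *
          (48 * (qhat q ^ 2) ^ 2 *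
            ((q : ℝ) ^ (-(3 / 2 : ℝ)) * ∑' k : ℕ, (k : ℝ) ^ (-(3 / 2 : ℝ))) ^ 2)) with hB
  -- uniform bound on the finite partial sums of `‖F‖`
  have hpart : ∀ s : Finset (ℕ × ℕ), ∑ n ∈ s, ‖F n‖ ≤ B := by
    intro s
    have h1 := Finset.sum_le_sum fun n (_ : n ∈ s) ↦
      norm_offSummand_le hε0.le hCε0 hCε hC₀0 hC₀ hq hl hlq hm hmq n
    refine h1.trans ?_
    rw [← Finset.mul_sum, Finset.sum_add_distrib, ← Finset.mul_sum, ← Finset.mul_sum]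
    have hA := sum_weightA_le hε0 hε hQ1 s
    have hBB := sum_weightB_le (q := q) hq.one_lt.le hQ2 s
    have hlm : (0 : ℝ) ≤ ((l : ℝ) * m) ^ (1 / 2 + ε) := Real.rpow_nonneg (by positivity) _
    rw [hB]
    gcongr
  have hsF : Summable (fun n ↦ ‖F n‖) := summable_of_sum_le (fun n ↦ norm_nonneg _) hpart
  have htsum : ‖∑' n, F n‖ ≤ B :=
    (norm_tsum_le_tsum_norm hsF).trans (hsF.tsum_le_of_sum_le hpart)
  have h2 : ‖(2 * (qhat q : ℂ))‖ = 2 * qhat q := by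
    rw [norm_mul, Complex.norm_two, Complex.norm_real, Real.norm_of_nonneg hQ0.le]
  rw [norm_mul, h2]
  exact mul_le_mul_of_nonneg_left htsum (by positivity)

/-- The `X²` mollifier coefficient is at most `m^{−1/2}` in absolute value (`M > 1`, `1 ≤ m ≤ M`).
[cite: KowalskiMichelVanderKam2000, (8)–(9) p. 7] -/
theorem abs_mollifierCoeff_X_sq_le {M : ℝ} (hM : 1 < M) {m : ℕ} (hm : m ∈ Icc 1 ⌊M⌋₊) :
    |mollifierCoeff (X ^ 2) M m| ≤ (m : ℝ) ^ (-(1 / 2 : ℝ)) := by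
  have hB : ∀ t ∈ Set.Icc (0 : ℝ) 1, |(X ^ 2 : ℝ[X]).eval t| ≤ 1 := by
    intro t ht
    rw [eval_pow, eval_X, abs_le]
    constructor <;> nlinarith [ht.1, ht.2]
  have h := KMV2000.abs_mollifierCoeff_le hB hM hm
  rw [one_mul] at h
  exact h

/-- For `q ≥ 400`: `q̂ = √q/2π ≥ 3`. [cite: KowalskiMichelVanderKam2000, §1 p. 1 (definition of q̂)] -/
theorem three_le_qhat {q : ℕ} (hq : 400 ≤ q) : 3 ≤ qhat q := by
  have hπ : π < 3.15 := Real.pi_lt_d2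
  have hq' : (400 : ℝ) ≤ q := by exact_mod_cast hq
  have hsq : (20 : ℝ) ≤ Real.sqrt q := by
    rw [show (20 : ℝ) = Real.sqrt (20 ^ 2) by rw [Real.sqrt_sq (by norm_num)]]
    exact Real.sqrt_le_sqrt (by nlinarith)
  unfold qhat
  rw [le_div_iff₀ (by positivity)]
  nlinarith [Real.pi_pos]

/-- **One mollified pair.** With the constants of `norm_offDiag_le` and the divisor bound
`τ(n) ≤ C_τ n^ε`: for `q` prime, `q̂ ≥ 1`, `1 < M < q` and `l, m ≤ M`,
`‖c_l c_m·OFF_q(l,m)‖ ≤ 2q̂ q^{−3/2} C_τ² [C_ε·SA·M^{4ε} + C₀·SB·M²]`, where `|c_m| ≤ m^{−1/2}`,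
`τ(l)τ(m)(lm)^ε ≤ C_τ² M^{4ε}` and `τ(l)τ(m)(lm)^{1/2} ≤ C_τ² M²` have been used
(`SA = 769(1+log q̂²)(q̂²)^{1+ε}`, `SB = 48 q̂⁴ (q^{−3/2}Σ k^{−3/2})²`).
[cite: KowalskiMichelVanderKam2000, §5 p. 13 («if one uses the Weil bound … only in the range Δ < 1/2») — derivation] -/
theorem norm_mollifiedPair_le {ε Cε C₀ Cτ : ℝ} (hε0 : 0 < ε) (hε : ε ≤ 1 / 2) (hCε0 : 0 ≤ Cε)
    (hCε : ∀ (q : ℕ) [NeZero q], q.Prime → ∀ m n : ℕ, 1 ≤ m → 1 ≤ n → ¬ (q ∣ m ∧ q ∣ n) →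
      ‖KowalskiMichel2000.petJ q m n‖ ≤
        Cε * (((m : ℝ) * n) ^ (1 / 2 + ε)) * (q : ℝ) ^ (-(3 / 2 : ℝ)))
    (hC₀0 : 0 ≤ C₀)
    (hC₀ : ∀ (q : ℕ) [NeZero q], q.Prime → ∀ a b : ℕ, 1 ≤ a →
      ‖KowalskiMichel2000.petJ q a b‖ ≤
        C₀ * Real.sqrt ((a.gcd b : ℕ) : ℝ) * Real.sqrt ((a : ℝ) * b) * (q : ℝ) ^ (-(3 / 2 : ℝ)))
    (hCτ : ∀ n : ℕ, n ≠ 0 → ((n.divisors.card : ℕ) : ℝ) ≤ Cτ * (n : ℝ) ^ ε)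
    {q : ℕ} [NeZero q] (hq : q.Prime) (hq1 : 1 ≤ qhat q) {M : ℝ} (hM1 : 1 < M) (hMq : M < q)
    {l m : ℕ} (hl : l ∈ Icc 1 ⌊M⌋₊) (hm : m ∈ Icc 1 ⌊M⌋₊) :
    ‖((mollifierCoeff (X ^ 2) M l * mollifierCoeff (X ^ 2) M m : ℝ) : ℂ) *
      (2 * (qhat q : ℂ) * ∑' n : ℕ × ℕ,
        (((((n.1 : ℝ) * n.2) ^ (-(1 / 2 : ℝ)) * cutoffW ((n.1 : ℝ) * n.2 / qhat q ^ 2)) : ℝ) : ℂ) *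
          ∑ d₁ ∈ (l.gcd n.1).divisors, ∑ d₂ ∈ (m.gcd n.2).divisors,
            KowalskiMichel2000.petJ q (l * n.1 / d₁ ^ 2) (m * n.2 / d₂ ^ 2))‖ ≤
      2 * qhat q * (q : ℝ) ^ (-(3 / 2 : ℝ)) * Cτ ^ 2 *
        (Cε * (769 * (1 + Real.log (qhat q ^ 2)) * (qhat q ^ 2) ^ (1 + ε)) * M ^ (4 * ε) +
          C₀ * (48 * (qhat q ^ 2) ^ 2 *
            ((q : ℝ) ^ (-(3 / 2 : ℝ)) * ∑' k : ℕ, (k : ℝ) ^ (-(3 / 2 : ℝ))) ^ 2) * M ^ 2) := by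
  have hQ0 : 0 < qhat q := lt_of_lt_of_le one_pos hq1
  have hq0 : (0 : ℝ) < q := by exact_mod_cast hq.pos
  have hM0 : 0 ≤ M := by linarith
  have hl' := Finset.mem_Icc.mp hl
  have hm' := Finset.mem_Icc.mp hm
  have hlM : (l : ℝ) ≤ M := (Nat.cast_le.mpr hl'.2).trans (Nat.floor_le hM0)
  have hmM : (m : ℝ) ≤ M := (Nat.cast_le.mpr hm'.2).trans (Nat.floor_le hM0)
  have hlq : l < q := by exact_mod_cast hlM.trans_lt hMq
  have hmq : m < q := by exact_mod_cast hmM.trans_lt hMq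
  have ha0 : (0 : ℝ) < l := by exact_mod_cast hl'.1
  have hb0 : (0 : ℝ) < m := by exact_mod_cast hm'.1
  have hab0 : (0 : ℝ) < (l : ℝ) * m := by positivity
  have habM : (l : ℝ) * m ≤ M ^ 2 := by
    rw [sq]; exact mul_le_mul hlM hmM hb0.le hM0
  have hcl := abs_mollifierCoeff_X_sq_le hM1 hl
  have hcm := abs_mollifierCoeff_X_sq_le hM1 hm
  have hoff := norm_offDiag_le hε0 hε hCε0 hCε hC₀0 hC₀ hq hq1 hl'.1 hlq hm'.1 hmq
  set OFF : ℂ := 2 * (qhat q : ℂ) * ∑' n : ℕ × ℕ,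
        (((((n.1 : ℝ) * n.2) ^ (-(1 / 2 : ℝ)) * cutoffW ((n.1 : ℝ) * n.2 / qhat q ^ 2)) : ℝ) : ℂ) *
          ∑ d₁ ∈ (l.gcd n.1).divisors, ∑ d₂ ∈ (m.gcd n.2).divisors,
            KowalskiMichel2000.petJ q (l * n.1 / d₁ ^ 2) (m * n.2 / d₂ ^ 2) with hOFF
  -- abbreviations (all nonnegative)
  obtain ⟨SA, hSA⟩ : ∃ SA : ℝ, SA = 769 * (1 + Real.log (qhat q ^ 2)) * (qhat q ^ 2) ^ (1 + ε) :=
    ⟨_, rfl⟩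
  obtain ⟨SB, hSB⟩ : ∃ SB : ℝ, SB = 48 * (qhat q ^ 2) ^ 2 *
      ((q : ℝ) ^ (-(3 / 2 : ℝ)) * ∑' k : ℕ, (k : ℝ) ^ (-(3 / 2 : ℝ))) ^ 2 := ⟨_, rfl⟩
  obtain ⟨T, hT⟩ : ∃ T : ℝ, T = ((l.divisors.card * m.divisors.card : ℕ) : ℝ) := ⟨_, rfl⟩
  have hSA0 : 0 ≤ SA := by
    have h1 : 0 ≤ Real.log (qhat q ^ 2) := Real.log_nonneg (by nlinarith)
    rw [hSA]; positivity
  have hSB0 : 0 ≤ SB := by rw [hSB]; positivity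
  have hT0 : 0 ≤ T := by rw [hT]; positivity
  rw [← hSA, ← hSB, ← hT] at hoff
  rw [← hSA, ← hSB]
  -- powers of `lm`
  have f1 : (l : ℝ) ^ (-(1 / 2 : ℝ)) * (m : ℝ) ^ (-(1 / 2 : ℝ)) *
      ((l : ℝ) * m) ^ (1 / 2 + ε) = ((l : ℝ) * m) ^ ε := by
    rw [← Real.mul_rpow ha0.le hb0.le, ← Real.rpow_add hab0]
    norm_num
  have f2 : (l : ℝ) ^ (-(1 / 2 : ℝ)) * (m : ℝ) ^ (-(1 / 2 : ℝ)) * ((l : ℝ) * m) =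
      ((l : ℝ) * m) ^ (1 / 2 : ℝ) := by
    rw [← Real.mul_rpow ha0.le hb0.le]
    have h : ((l : ℝ) * m) ^ (-(1 / 2 : ℝ)) * ((l : ℝ) * m) ^ (1 : ℝ) =
        ((l : ℝ) * m) ^ (1 / 2 : ℝ) := by
      rw [← Real.rpow_add hab0]; norm_num
    rwa [Real.rpow_one] at h
  have f3 : T ≤ Cτ ^ 2 * ((l : ℝ) * m) ^ ε := by
    have h1 := hCτ l (by omega)
    have h2 := hCτ m (by omega)
    rw [hT]
    push_cast
    calc (l.divisors.card : ℝ) * (m.divisors.card : ℝ)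
        ≤ (Cτ * (l : ℝ) ^ ε) * (Cτ * (m : ℝ) ^ ε) :=
          mul_le_mul h1 h2 (Nat.cast_nonneg _) ((Nat.cast_nonneg _).trans h1)
      _ = Cτ ^ 2 * ((l : ℝ) * m) ^ ε := by rw [Real.mul_rpow ha0.le hb0.le]; ring
  have f4 : ((l : ℝ) * m) ^ ε * ((l : ℝ) * m) ^ ε ≤ M ^ (4 * ε) := by
    rw [← Real.rpow_add hab0]
    calc ((l : ℝ) * m) ^ (ε + ε) ≤ (M ^ 2) ^ (ε + ε) :=
          Real.rpow_le_rpow hab0.le habM (by linarith)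
      _ = M ^ (4 * ε) := by
          rw [← Real.rpow_natCast M 2, ← Real.rpow_mul hM0]
          congr 1; push_cast; ring
  have f5 : ((l : ℝ) * m) ^ ε * ((l : ℝ) * m) ^ (1 / 2 : ℝ) ≤ M ^ 2 := by
    rw [← Real.rpow_add hab0]
    calc ((l : ℝ) * m) ^ (ε + 1 / 2) ≤ (M ^ 2) ^ (ε + 1 / 2) :=
          Real.rpow_le_rpow hab0.le habM (by linarith)
      _ = M ^ (2 * (ε + 1 / 2)) := by
          rw [← Real.rpow_natCast M 2, ← Real.rpow_mul hM0]; norm_num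
      _ ≤ M ^ (2 : ℝ) := Real.rpow_le_rpow_of_exponent_le hM1.le (by linarith)
      _ = M ^ 2 := Real.rpow_two M
  have hCτ2 : 0 ≤ Cτ ^ 2 * ((l : ℝ) * m) ^ ε := le_trans hT0 f3
  -- assemble
  rw [norm_mul, Complex.norm_real, Real.norm_eq_abs, abs_mul]
  calc |mollifierCoeff (X ^ 2) M l| * |mollifierCoeff (X ^ 2) M m| * ‖OFF‖
      ≤ ((l : ℝ) ^ (-(1 / 2 : ℝ)) * (m : ℝ) ^ (-(1 / 2 : ℝ))) *
        (2 * qhat q * (T * (q : ℝ) ^ (-(3 / 2 : ℝ)) *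
          (Cε * ((l : ℝ) * m) ^ (1 / 2 + ε) * SA + C₀ * ((l : ℝ) * m) * SB))) :=
        mul_le_mul (mul_le_mul hcl hcm (abs_nonneg _) (Real.rpow_nonneg ha0.le _))
          hoff (norm_nonneg _) (by positivity)
    _ = 2 * qhat q * (q : ℝ) ^ (-(3 / 2 : ℝ)) *
        (Cε * SA * (T * ((l : ℝ) ^ (-(1 / 2 : ℝ)) * (m : ℝ) ^ (-(1 / 2 : ℝ)) *
            ((l : ℝ) * m) ^ (1 / 2 + ε))) +
          C₀ * SB * (T * ((l : ℝ) ^ (-(1 / 2 : ℝ)) * (m : ℝ) ^ (-(1 / 2 : ℝ)) *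
            ((l : ℝ) * m)))) := by ring
    _ = 2 * qhat q * (q : ℝ) ^ (-(3 / 2 : ℝ)) *
        (Cε * SA * (T * ((l : ℝ) * m) ^ ε) + C₀ * SB * (T * ((l : ℝ) * m) ^ (1 / 2 : ℝ))) := by
        rw [f1, f2]
    _ ≤ 2 * qhat q * (q : ℝ) ^ (-(3 / 2 : ℝ)) *
        (Cε * SA * ((Cτ ^ 2 * ((l : ℝ) * m) ^ ε) * ((l : ℝ) * m) ^ ε) +
          C₀ * SB * ((Cτ ^ 2 * ((l : ℝ) * m) ^ ε) * ((l : ℝ) * m) ^ (1 / 2 : ℝ))) := by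
        gcongr
    _ = 2 * qhat q * (q : ℝ) ^ (-(3 / 2 : ℝ)) * Cτ ^ 2 *
        (Cε * SA * (((l : ℝ) * m) ^ ε * ((l : ℝ) * m) ^ ε) +
          C₀ * SB * (((l : ℝ) * m) ^ ε * ((l : ℝ) * m) ^ (1 / 2 : ℝ))) := by ring
    _ ≤ 2 * qhat q * (q : ℝ) ^ (-(3 / 2 : ℝ)) * Cτ ^ 2 *
        (Cε * SA * M ^ (4 * ε) + C₀ * SB * M ^ 2) := by
        gcongr

/-- Bookkeeping in powers of `Q = q̂` for the generic term: with `M = Q^Δ`, `q^{−3/2} ≤ Q^{−3}`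
and `2ε + Δ(2+4ε) = 1/2 + Δ`:
`M²·(2Q·q^{−3/2}·C_τ²·C_ε·769(1 + log Q²)(Q²)^{1+ε}·M^{4ε}) ≤ 1538 C_τ² C_ε (1 + 2 log Q)·Q^{1/2+Δ}`.
[folklore] -/
private theorem term1_le {ε Δ Cε Cτ Q q32 : ℝ} (hQ1 : 1 ≤ Q) (hCε0 : 0 ≤ Cε)
    (hq32' : q32 ≤ Q ^ (-(3 : ℝ))) (hexp : 2 * ε + Δ * (2 + 4 * ε) = 1 / 2 + Δ) :
    (Q ^ Δ) ^ 2 * (2 * Q * q32 * Cτ ^ 2 *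
        (Cε * (769 * (1 + Real.log (Q ^ 2)) * (Q ^ 2) ^ (1 + ε)) * (Q ^ Δ) ^ (4 * ε))) ≤
      1538 * Cτ ^ 2 * Cε * (1 + 2 * Real.log Q) * Q ^ (1 / 2 + Δ) := by
  have hQ0 : 0 < Q := by linarith
  have hlogQ2 : Real.log (Q ^ 2) = 2 * Real.log Q := by rw [Real.log_pow]; push_cast; ring
  have hlog0 : 0 ≤ Real.log Q := Real.log_nonneg hQ1
  have hM2 : (Q ^ Δ) ^ 2 = Q ^ (Δ * 2) := by
    rw [← Real.rpow_natCast (Q ^ Δ) 2, ← Real.rpow_mul hQ0.le]; norm_num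
  have hM4e : (Q ^ Δ) ^ (4 * ε) = Q ^ (Δ * (4 * ε)) := by rw [← Real.rpow_mul hQ0.le]
  have hQ2e : (Q ^ 2) ^ (1 + ε) = Q ^ (2 * (1 + ε)) := by
    rw [← Real.rpow_natCast Q 2, ← Real.rpow_mul hQ0.le]; norm_num
  have hpow : Q ^ (1 : ℝ) * Q ^ (-(3 : ℝ)) * Q ^ (2 * (1 + ε)) *
      (Q ^ (Δ * 2) * Q ^ (Δ * (4 * ε))) = Q ^ (1 / 2 + Δ) := by
    simp only [← Real.rpow_add hQ0]
    congr 1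
    linear_combination hexp
  calc (Q ^ Δ) ^ 2 * (2 * Q * q32 * Cτ ^ 2 *
        (Cε * (769 * (1 + Real.log (Q ^ 2)) * (Q ^ 2) ^ (1 + ε)) * (Q ^ Δ) ^ (4 * ε)))
      = 2 * Cτ ^ 2 * Cε * (769 * (1 + Real.log (Q ^ 2)) * (Q ^ 2) ^ (1 + ε)) * q32 *
          (Q * ((Q ^ Δ) ^ 2 * (Q ^ Δ) ^ (4 * ε))) := by ring
    _ ≤ 2 * Cτ ^ 2 * Cε * (769 * (1 + Real.log (Q ^ 2)) * (Q ^ 2) ^ (1 + ε)) * Q ^ (-(3 : ℝ)) *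
          (Q * ((Q ^ Δ) ^ 2 * (Q ^ Δ) ^ (4 * ε))) := by
        have h1 : 0 ≤ 1 + Real.log (Q ^ 2) := by rw [hlogQ2]; positivity
        gcongr
    _ = 1538 * Cτ ^ 2 * Cε * (1 + 2 * Real.log Q) *
          (Q ^ (1 : ℝ) * Q ^ (-(3 : ℝ)) * Q ^ (2 * (1 + ε)) * (Q ^ (Δ * 2) * Q ^ (Δ * (4 * ε)))) := by
        rw [hlogQ2, hQ2e, hM2, hM4e, Real.rpow_one]; ring
    _ = 1538 * Cτ ^ 2 * Cε * (1 + 2 * Real.log Q) * Q ^ (1 / 2 + Δ) := by rw [hpow]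

/-- Bookkeeping for the level-multiples term: with `M ≤ Q` and `q^{−3/2} ≤ Q^{−3}`,
`M²·(2Q·q^{−3/2}·C_τ²·C₀·48 Q⁴ (q^{−3/2} Z)²·M²) ≤ 96 C_τ² C₀ Z²` (the powers of `Q` cancel).
[folklore] -/
private theorem term2_le {Cτ C₀ Z Q M q32 : ℝ} (hQ0 : 0 < Q) (hC₀0 : 0 ≤ C₀)
    (hq32 : 0 ≤ q32) (hq32' : q32 ≤ Q ^ (-(3 : ℝ))) (hM0 : 0 ≤ M) (hMQ : M ≤ Q) :
    M ^ 2 * (2 * Q * q32 * Cτ ^ 2 * (C₀ * (48 * (Q ^ 2) ^ 2 * (q32 * Z) ^ 2) * M ^ 2)) ≤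
      96 * Cτ ^ 2 * C₀ * Z ^ 2 := by
  have hM4 : M ^ 2 * M ^ 2 ≤ Q ^ 4 := by
    rw [← pow_add]; exact pow_le_pow_left₀ hM0 hMQ 4
  have hQ4 : (Q ^ 4 : ℝ) = Q ^ (4 : ℝ) := by rw [← Real.rpow_natCast Q 4]; norm_num
  have hpow : Q ^ (1 : ℝ) * Q ^ (-(3 : ℝ)) * (Q ^ (4 : ℝ) * (Q ^ (-(3 : ℝ)) * Q ^ (-(3 : ℝ)))) *
      Q ^ (4 : ℝ) = 1 := by
    simp only [← Real.rpow_add hQ0]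
    norm_num
  calc M ^ 2 * (2 * Q * q32 * Cτ ^ 2 * (C₀ * (48 * (Q ^ 2) ^ 2 * (q32 * Z) ^ 2) * M ^ 2))
      = 96 * Cτ ^ 2 * C₀ * Z ^ 2 * q32 * (q32 * q32) * (Q * (Q ^ 2) ^ 2 * (M ^ 2 * M ^ 2)) := by
        ring
    _ ≤ 96 * Cτ ^ 2 * C₀ * Z ^ 2 * Q ^ (-(3 : ℝ)) * (Q ^ (-(3 : ℝ)) * Q ^ (-(3 : ℝ))) *
          (Q * (Q ^ 2) ^ 2 * Q ^ 4) := by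
        gcongr
    _ = 96 * Cτ ^ 2 * C₀ * Z ^ 2 * (Q ^ (1 : ℝ) * Q ^ (-(3 : ℝ)) *
          (Q ^ (4 : ℝ) * (Q ^ (-(3 : ℝ)) * Q ^ (-(3 : ℝ)))) * Q ^ (4 : ℝ)) := by
        rw [Real.rpow_one, ← hQ4]; ring
    _ = 96 * Cτ ^ 2 * C₀ * Z ^ 2 := by rw [hpow, mul_one]

/-- The final numerical step: for `Q ≥ 3` (so `L = log Q ≥ 1`), `γ > 0` with `γ + (1/2 + Δ) = 1`
and `K ≥ 0`: `K·(1 + 2L)·Q^{1/2+Δ} ≤ 3K(4/γ)⁴ · Q · L^{−3}` (`1 + 2L ≤ 3L`, `L⁴ ≤ (4/γ)⁴ Q^γ`).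
[folklore] -/
private theorem final_le {K γ Δ Q : ℝ} (hK : 0 ≤ K) (hγ0 : 0 < γ) (hγ : γ + (1 / 2 + Δ) = 1)
    (hQ3 : 3 ≤ Q) :
    K * (1 + 2 * Real.log Q) * Q ^ (1 / 2 + Δ) ≤
      3 * K * (4 / γ) ^ 4 * Q * (Real.log Q)⁻¹ ^ 3 := by
  have hQ0 : 0 < Q := by linarith
  have hL1 : 1 ≤ Real.log Q := by
    rw [Real.le_log_iff_exp_le hQ0]
    have := Real.exp_one_lt_d9
    linarith
  have hL0 : 0 < Real.log Q := by linarith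
  have hL4 : Real.log Q ^ 4 ≤ (4 / γ) ^ 4 * Q ^ γ := by
    have h := Real.log_le_rpow_div hQ0.le (by positivity : 0 < γ / 4)
    have h' : Real.log Q ≤ 4 / γ * Q ^ (γ / 4) := by
      calc Real.log Q ≤ Q ^ (γ / 4) / (γ / 4) := h
        _ = 4 / γ * Q ^ (γ / 4) := by field_simp
    calc Real.log Q ^ 4 ≤ (4 / γ * Q ^ (γ / 4)) ^ 4 := pow_le_pow_left₀ hL0.le h' 4
      _ = (4 / γ) ^ 4 * (Q ^ (γ / 4)) ^ 4 := mul_pow _ _ 4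
      _ = (4 / γ) ^ 4 * Q ^ γ := by
          rw [← Real.rpow_natCast (Q ^ (γ / 4)) 4, ← Real.rpow_mul hQ0.le]; norm_num
  have e2 : Q ^ γ * Q ^ (1 / 2 + Δ) = Q := by
    rw [← Real.rpow_add hQ0, hγ, Real.rpow_one]
  have hQp : 0 ≤ Q ^ (1 / 2 + Δ) := Real.rpow_nonneg hQ0.le _
  calc K * (1 + 2 * Real.log Q) * Q ^ (1 / 2 + Δ)
      ≤ K * (3 * Real.log Q) * Q ^ (1 / 2 + Δ) := by gcongr; linarith
    _ = 3 * K * Real.log Q ^ 4 * (Real.log Q)⁻¹ ^ 3 * Q ^ (1 / 2 + Δ) := by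
        field_simp
    _ ≤ 3 * K * ((4 / γ) ^ 4 * Q ^ γ) * (Real.log Q)⁻¹ ^ 3 * Q ^ (1 / 2 + Δ) := by gcongr
    _ = 3 * K * (4 / γ) ^ 4 * (Q ^ γ * Q ^ (1 / 2 + Δ)) * (Real.log Q)⁻¹ ^ 3 := by ring
    _ = 3 * K * (4 / γ) ^ 4 * Q * (Real.log Q)⁻¹ ^ 3 := by rw [e2]

/-- **Abstract assembly** of the per-pair bound over the `⌊M⌋²` pairs with the bookkeeping lemmas
`term1_le`, `term2_le`, `final_le`: a double sum of terms each at most the per-pair bound `U` is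
`≤ 3(1538 C_τ²C_ε + 96 C_τ²C₀Z²)(4/γ)⁴ · Q · (log Q)^{−3}`. [folklore] -/
private theorem doubleSum_le_of_pair_le {ε Δ γ Cε C₀ Cτ Z Q M q32 : ℝ} {S : Finset ℕ} {F : ℕ → ℕ → ℂ}
    (hCε0 : 0 ≤ Cε) (hC₀0 : 0 ≤ C₀) (hQ3 : 3 ≤ Q) (hM : M = Q ^ Δ) (hΔ0 : 0 < Δ)
    (hΔ1 : Δ ≤ 1) (hq32 : 0 ≤ q32) (hq32' : q32 ≤ Q ^ (-(3 : ℝ)))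
    (hexp : 2 * ε + Δ * (2 + 4 * ε) = 1 / 2 + Δ) (hγ0 : 0 < γ) (hγ : γ + (1 / 2 + Δ) = 1)
    (hcard : (S.card : ℝ) ≤ M)
    (hpair : ∀ l ∈ S, ∀ m ∈ S, ‖F l m‖ ≤ 2 * Q * q32 * Cτ ^ 2 *
      (Cε * (769 * (1 + Real.log (Q ^ 2)) * (Q ^ 2) ^ (1 + ε)) * M ^ (4 * ε) +
        C₀ * (48 * (Q ^ 2) ^ 2 * (q32 * Z) ^ 2) * M ^ 2)) :
    ‖∑ l ∈ S, ∑ m ∈ S, F l m‖ ≤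
      3 * (1538 * Cτ ^ 2 * Cε + 96 * Cτ ^ 2 * C₀ * Z ^ 2) * (4 / γ) ^ 4 * Q * (Real.log Q)⁻¹ ^ 3 := by
  have hQ1 : 1 ≤ Q := by linarith
  have hQ0 : 0 < Q := by linarith
  have hM1 : 1 ≤ M := hM ▸ Real.one_le_rpow hQ1 hΔ0.le
  have hM0 : 0 ≤ M := by linarith
  have hMQ : M ≤ Q := by
    rw [hM]
    calc Q ^ Δ ≤ Q ^ (1 : ℝ) := Real.rpow_le_rpow_of_exponent_le hQ1 hΔ1
      _ = Q := Real.rpow_one Q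
  have hlog0 : 0 ≤ 1 + Real.log (Q ^ 2) := by
    have : 0 ≤ Real.log (Q ^ 2) := Real.log_nonneg (one_le_pow₀ hQ1)
    linarith
  have hK0 : 0 ≤ 1538 * Cτ ^ 2 * Cε + 96 * Cτ ^ 2 * C₀ * Z ^ 2 := by positivity
  calc ‖∑ l ∈ S, ∑ m ∈ S, F l m‖
      ≤ ∑ l ∈ S, ‖∑ m ∈ S, F l m‖ := norm_sum_le _ _
    _ ≤ ∑ l ∈ S, ∑ m ∈ S, ‖F l m‖ := Finset.sum_le_sum fun l _ ↦ norm_sum_le _ _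
    _ ≤ ∑ l ∈ S, ∑ m ∈ S, (2 * Q * q32 * Cτ ^ 2 *
          (Cε * (769 * (1 + Real.log (Q ^ 2)) * (Q ^ 2) ^ (1 + ε)) * M ^ (4 * ε) +
            C₀ * (48 * (Q ^ 2) ^ 2 * (q32 * Z) ^ 2) * M ^ 2)) :=
        Finset.sum_le_sum fun l hl ↦ Finset.sum_le_sum fun m hm ↦ hpair l hl m hm
    _ = (S.card : ℝ) * (S.card : ℝ) * (2 * Q * q32 * Cτ ^ 2 *
          (Cε * (769 * (1 + Real.log (Q ^ 2)) * (Q ^ 2) ^ (1 + ε)) * M ^ (4 * ε) +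
            C₀ * (48 * (Q ^ 2) ^ 2 * (q32 * Z) ^ 2) * M ^ 2)) := by
        rw [Finset.sum_const, Finset.sum_const, smul_smul, nsmul_eq_mul]; push_cast; ring
    _ ≤ M * M * (2 * Q * q32 * Cτ ^ 2 *
          (Cε * (769 * (1 + Real.log (Q ^ 2)) * (Q ^ 2) ^ (1 + ε)) * M ^ (4 * ε) +
            C₀ * (48 * (Q ^ 2) ^ 2 * (q32 * Z) ^ 2) * M ^ 2)) := by
        gcongr
    _ = M ^ 2 * (2 * Q * q32 * Cτ ^ 2 *
          (Cε * (769 * (1 + Real.log (Q ^ 2)) * (Q ^ 2) ^ (1 + ε)) * M ^ (4 * ε))) +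
        M ^ 2 * (2 * Q * q32 * Cτ ^ 2 *
          (C₀ * (48 * (Q ^ 2) ^ 2 * (q32 * Z) ^ 2) * M ^ 2)) := by ring
    _ ≤ 1538 * Cτ ^ 2 * Cε * (1 + 2 * Real.log Q) * Q ^ (1 / 2 + Δ) +
        96 * Cτ ^ 2 * C₀ * Z ^ 2 := by
        refine add_le_add ?_ (term2_le hQ0 hC₀0 hq32 hq32' hM0 hMQ)
        rw [hM]
        exact term1_le hQ1 hCε0 hq32' hexp
    _ ≤ (1538 * Cτ ^ 2 * Cε + 96 * Cτ ^ 2 * C₀ * Z ^ 2) * (1 + 2 * Real.log Q) *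
        Q ^ (1 / 2 + Δ) := by
        have hL : 1 ≤ (1 + 2 * Real.log Q) * Q ^ (1 / 2 + Δ) := by
          have h1 : 1 ≤ 1 + 2 * Real.log Q := by
            have := Real.log_nonneg hQ1; linarith
          have h2 : 1 ≤ Q ^ (1 / 2 + Δ) := Real.one_le_rpow hQ1 (by linarith)
          nlinarith
        have hK₂ : 0 ≤ 96 * Cτ ^ 2 * C₀ * Z ^ 2 := by positivity
        nlinarith
    _ ≤ 3 * (1538 * Cτ ^ 2 * Cε + 96 * Cτ ^ 2 * C₀ * Z ^ 2) * (4 / γ) ^ 4 * Q *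
        (Real.log Q)⁻¹ ^ 3 := final_le hK0 hγ0 hγ hQ3

/-- **The mollified off-diagonal of the second moment on the Weil range.** For `0 < Δ < 1/2`
there are `C, q₀` such that for every prime `q ≥ q₀`, at `M = q̂^Δ`,
`‖Σ_{l,m ≤ M} c_l c_m·OFF_q(l,m)‖ ≤ C·q̂·(log q̂)^{−3}`, `c_m = μ(m)ψ(m)⁻¹m^{−1/2}(log(M/m)/log M)²`
the KMV `X²` mollifier coefficients (`mollifierCoeff (X^2)`) and `OFF_q(l,m) =
2q̂ Σ_{n₁,n₂} (n₁n₂)^{−1/2}W(n₁n₂/q̂²) Σ_{d₁∣(l,n₁)} Σ_{d₂∣(m,n₂)} J_q(l n₁/d₁², m n₂/d₂²)` the explicit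
Kloosterman–Bessel double series of the exact Petersson/AFE split of `Q^h(X²,1)` (the off-diagonal of
KMV (21)–(23) ⊗ Lemma 3.1 ⊗ Petersson at prime level; written out, so that the Summit-side
`PeterssonSplit.offDiag q l m` unfolds to it by `rfl`). The proof gives `≪ (1 + log q̂)·q̂^{1/2+Δ}`: this
is KMV's remark that with Weil's bound alone the off-diagonal is an error term exactly for `Δ < 1/2`.
[cite: KowalskiMichelVanderKam2000, §5 p. 13 («if one uses the Weil bound on the individual Kloosterman sums, this follows only in the range Δ < 1/2») and Lemma 3.2 (12) p. 8 — derivation] -/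
theorem norm_mollified_offDiag_le {Δ : ℝ} (hΔ0 : 0 < Δ) (hΔ : Δ < 1 / 2) :
    ∃ C : ℝ, ∃ q₀ : ℕ, ∀ (q : ℕ) [NeZero q], q.Prime → q₀ ≤ q →
      ‖∑ l ∈ Icc 1 ⌊qhat q ^ Δ⌋₊, ∑ m ∈ Icc 1 ⌊qhat q ^ Δ⌋₊,
          ((mollifierCoeff (X ^ 2) (qhat q ^ Δ) l * mollifierCoeff (X ^ 2) (qhat q ^ Δ) m : ℝ) : ℂ) *
            (2 * (qhat q : ℂ) * ∑' n : ℕ × ℕ,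
        (((((n.1 : ℝ) * n.2) ^ (-(1 / 2 : ℝ)) * cutoffW ((n.1 : ℝ) * n.2 / qhat q ^ 2)) : ℝ) : ℂ) *
          ∑ d₁ ∈ (l.gcd n.1).divisors, ∑ d₂ ∈ (m.gcd n.2).divisors,
            KowalskiMichel2000.petJ q (l * n.1 / d₁ ^ 2) (m * n.2 / d₂ ^ 2))‖ ≤
        C * qhat q * (Real.log (qhat q))⁻¹ ^ 3 := by
  -- the auxiliary exponent `ε` with `2ε + Δ(2 + 4ε) = 1/2 + Δ`
  obtain ⟨ε, hε0, hε2, hexp⟩ : ∃ ε : ℝ, 0 < ε ∧ ε ≤ 1 / 2 ∧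
      2 * ε + Δ * (2 + 4 * ε) = 1 / 2 + Δ := by
    refine ⟨(1 - 2 * Δ) / (4 * (1 + 2 * Δ)), ?_, ?_, ?_⟩
    · apply div_pos <;> linarith
    · rw [div_le_iff₀ (by linarith)]; nlinarith
    · field_simp; ring
  -- constants
  obtain ⟨Cε', hCε'⟩ := KowalskiMichel2000.norm_petJ_le hε0
  obtain ⟨C₀, hC₀0, hC₀⟩ := norm_petJ_le_gcd
  obtain ⟨Cτ, hCτ1, hCτ⟩ := Literature.NumberTheory.Sieve.exists_card_divisors_le_mul_rpow hε0
  obtain ⟨Cε, hCεdef⟩ : ∃ Cε : ℝ, Cε = max Cε' 0 := ⟨_, rfl⟩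
  have hCε0 : 0 ≤ Cε := hCεdef ▸ le_max_right _ _
  have hCε : ∀ (q : ℕ) [NeZero q], q.Prime → ∀ m n : ℕ, 1 ≤ m → 1 ≤ n → ¬ (q ∣ m ∧ q ∣ n) →
      ‖KowalskiMichel2000.petJ q m n‖ ≤
        Cε * (((m : ℝ) * n) ^ (1 / 2 + ε)) * (q : ℝ) ^ (-(3 / 2 : ℝ)) := by
    intro q _ hq m n hm hn h
    refine (hCε' q hq m n hm hn h).trans ?_
    exact mul_le_mul_of_nonneg_right (mul_le_mul_of_nonneg_right (hCεdef ▸ le_max_left _ _)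
      (Real.rpow_nonneg (by positivity) _)) (Real.rpow_nonneg (Nat.cast_nonneg _) _)
  have hγ0 : 0 < 1 / 2 - Δ := by linarith
  refine ⟨3 * (1538 * Cτ ^ 2 * Cε + 96 * Cτ ^ 2 * C₀ * (∑' k : ℕ, (k : ℝ) ^ (-(3 / 2 : ℝ))) ^ 2) *
    (4 / (1 / 2 - Δ)) ^ 4, 400, fun q _ hq hq400 ↦ ?_⟩
  -- the level `q̂ ≥ 3` and the length `M = q̂^Δ < q`
  have hQ3 : 3 ≤ qhat q := three_le_qhat hq400
  have hQ1 : 1 ≤ qhat q := by linarith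
  have hQ0 : 0 < qhat q := by linarith
  have hq0 : (0 : ℝ) < q := by exact_mod_cast hq.pos
  have hM1 : 1 < qhat q ^ Δ := Real.one_lt_rpow (by linarith) hΔ0
  have hM0 : 0 ≤ qhat q ^ Δ := by linarith
  have hMQ : qhat q ^ Δ ≤ qhat q := by
    calc qhat q ^ Δ ≤ qhat q ^ (1 : ℝ) := Real.rpow_le_rpow_of_exponent_le hQ1 (by linarith)
      _ = qhat q := Real.rpow_one _
  have hQsq : qhat q ^ 2 ≤ q := by
    unfold qhat
    rw [div_pow, Real.sq_sqrt hq0.le]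
    exact div_le_self hq0.le (by nlinarith [Real.pi_gt_three])
  have hMq : qhat q ^ Δ < q := by
    have : qhat q < qhat q ^ 2 := by nlinarith
    linarith
  have hq32 : (q : ℝ) ^ (-(3 / 2 : ℝ)) ≤ qhat q ^ (-(3 : ℝ)) := by
    have h := Real.rpow_le_rpow_of_nonpos (by positivity : 0 < qhat q ^ 2) hQsq
      (by norm_num : (-(3 / 2 : ℝ)) ≤ 0)
    refine h.trans (le_of_eq ?_)
    rw [← Real.rpow_natCast (qhat q) 2, ← Real.rpow_mul hQ0.le]
    norm_num
  have hq32nn : 0 ≤ (q : ℝ) ^ (-(3 / 2 : ℝ)) := Real.rpow_nonneg hq0.le _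
  have hcard : ((Icc 1 ⌊qhat q ^ Δ⌋₊).card : ℝ) ≤ qhat q ^ Δ := by
    rw [Nat.card_Icc]; simp only [add_tsub_cancel_right]; exact Nat.floor_le hM0
  exact doubleSum_le_of_pair_le hCε0 hC₀0 hQ3 rfl hΔ0 (by linarith) hq32nn hq32 hexp hγ0
    (by ring) hcard
    (fun l hl m hm ↦ norm_mollifiedPair_le hε0 hε2 hCε0 hCε hC₀0 hC₀ hCτ hq hQ1 hM1 hMq hl hm)

end Literature.NumberTheory.LFunctions.KMV2000.WeilOffDiag
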